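import Literature.Probability.RandomPlanarGeometry.YangBaxterSAWExcursionJordan
import Literature.Barriers.CriticalPhenomena.PlaquetteWalkHoleRootFarCellLaw
import HarnessLib

/-!
# Barrier catalogue (SAWScalingLimit): the LATERAL-CELL LAW of a hole root

Companion of `PlaquetteWalkHoleRootFarCellLaw` (the far cell `(w.1 − 2, w.2)` of the hole root `w.side W`, hole
`holeFaceW w = (w.1 − 1, w.2) ∉ D`). Here the rhombus is the LATERAL cell NORTH of the hole,
`latN w = (w.1 − 1, w.2 + 1)`, whose dead side is `S` (it faces the hole) and whose two live entrances for a class-`B2a`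
excursion rooted at `a = w.side W` are `E` (straight up from the root plaquette `w`) and `W` (under and around the hole).

## Results (all unconditional, axioms `propext`, `Classical.choice`, `Quot.sound`)

* `ΩG.firstSide_eq_E_or_W_of_wound` — (R1) at the lateral cell (from the tree's `ΩG.firstSide_lateral_of_wound`,
  dead side `S`): a wound class-`B2a` walk entered `latN w` from `E` or from `W`.
* ★ `ΩG.WP_latN_eq_of_wound` — THE SHORT TURNING IS FORCED: for every WOUND class-`B2a` walk at `latN w`, first side
  `E` ⇒ `WP(π/2) = π`, first side `W` ⇒ `WP(π/2) = −2π` (`WP` = turning of the prefix from the root mid-edge to the first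
  hit of the rhombus). Proof = two UNSIGNED discrete Umlaufsätze (`hopf_cyclic_int` of the far-cell file, i.e. the
  tree's `HopfClosed`): the prefix closed up through the cell and the hole gives `WP(π/2) ∈ {π, −3π}` (`E`) /
  `{2π, −2π}` (`W`) (`ΩG.WP_pi_div_two_mem_latN`); the whole walk closed up through the hole, for the corner patterns
  `(z₀, z₁, z₂) = (E, N, W), (W, N, E)`, combined with the sign law of the far-cell file (`ΩG.sign_law`: wound ⇒
  `WE(π/2) = excursionWinding(π/2) ∓ 4π`) pins the value (`ΩG.WP_latN_eq_corner`); the straight patterns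
  `(E, W, N), (W, E, N)` are reduced to the corner ones by walk reversal (`ΩG.rev`).
* `ΩG.WP_latN_const` — `WP(θ) = WP(π/2)` (root and first side are vertical mid-edges).
* `latN_termE`, `latN_termW` — the class-term algebra: `phase(π)·ε·backBracket(θ; E, …, S) = −v(θ)·latDir θ` and
  `phase(−2π)·ε·backBracket(θ; W, …, S) = +v(θ)·latDir θ`, `latDir θ = e^{i(3θ/8 + 5π/8)}`, `v = weightV` the printed
  weight of [Glazman2015WeightedSAW, eq. (1)].
* ★★ `ΩG.classTerm_latN`, `ΩG.sum_classTerm_latN` — `classTerm = v(θ)·latDir θ·(routeMassL W − routeMassL E)`.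
* ★★★ `PlaquetteWalk.vertexFunctional_printed_latN_eq` — THE LATERAL-CELL LAW: for `θ ∈ [π/3, 2π/3]`,
  `latN w ∈ Dl`, `holeFaceW w ∉ dom Dl`:
  `vertexFunctional (printedWeights θ) tFiveEighths (ybCoeff θ) Dl (w.side W) (latN w)
     = i·v(θ)·e^{i(3θ/8 + 5π/8)}·(M_W − M_E)`,
  `M_s = Σ_{ω ∈ B2a} routeMassL θ hr s ω ≥ 0` the total exterior weight of the wound class-`B2a` walks entering from `s`;
  `…_eq_zero_iff`: the defect vanishes iff `M_W = M_E`. So the defect at the lateral cell lies on the FIXED LINE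
  `i·e^{i(3θ/8 + 5π/8)}·ℝ`, at the fixed angle `+π/2·` from the far-cell line `i·ℝ·v` rotated by `e^{i(3θ/8+5π/8)}`.

* § Three doors (two-door zeros recovered): a wound class-`B2a` walk at `latN w` uses all three live doors —
  `rootN w = (w.1, w.2 + 1)`, `farNW w`, `latNN w = (w.1 − 1, w.2 + 2)` all lie in the domain
  (`ΩG.doors_of_wound_latN`); if any is absent, `VF_D(a, latN w) = 0` for every `θ ∈ [π/3, 2π/3]`
  (`…_latN_eq_zero_of_door_closed`) — the catalogue's two-door zeros, seen from the route masses.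

* § The honeycomb point (edition 4): at `θ = π/3` (weights `(x_c, x_c², x_c², x_c², 0)`, the hexagonal-lattice walk at
  `x_c`; companion file, edition 6) ★★ `…_latN_pi_div_three_eq`:
  `VF_D(a, latN w; π/3) = i·x_c²·e^{3iπ/4}·(Σ_{W, w₂-free wound} x_c^ℓ − Σ_{E, w₂-free wound} x_c^ℓ)` (`ΩG.hexRouteMassL`);
  ROUTE KILLS `…_latN_pi_div_three_ne_zero_of_east_killed` / `_of_west_killed`; HONEYCOMB ZERO
  `…_latN_pi_div_three_eq_zero_of_killed`.

## Sources

The vertex relation and its class decomposition: [GlazmanManolescu2019, Lemma 2.1, "in the form given in [Gl]"] and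
[Glazman2015WeightedSAW, Lemma 3.1 and its proof, pp. 6–7] (classes of walks through a rhombus, the weights
`u₁, u₂, v, w₁, w₂` of eq. (1)); the winding bookkeeping of [DuminilCopinSmirnov2012, proof of Lemma 1]; the
turning-number theorem [Hopf1935, Nr. 2 (Umlaufsatz, p. 53) and Nr. 4, eq. (22) (curves with corners, pp. 60–61)],
used through the tree's discrete version. NOT claimed: anything about the sign of `M_W − M_E`, or about cells other
than `latN w`; the mirror cell `(w.1 − 1, w.2 − 1)` is the reflection of this file and is not spelled out.
-/

/-! ## Private twins of the leaf `PlaquetteWalkHoleRootFarCellRoutes` (CLASS-S edition)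

This edition is meant to build on the CLASS-S edition of the far-cell law while the leaf
`PlaquetteWalkHoleRootFarCellRoutes` is not yet built on the mirror; that leaf's results used below ((R1)
`firstSide_lateral_of_wound`, the door lemma `firstSide_ne_dead` and their chain) are carried as PRIVATE twins with the
suffix `FRL` — the leaf remains their citable home. -/

noncomputable section

namespace Literature.Probability.RandomPlanarGeometry.SAW.YangBaxter

open Real Complex

/-- (Duplicated from `PlaquetteWalkHoleRootFarCellRoutes` for build reasons; that leaf is the citable home of (R1) and of the route algebra.) Two phases multiply by adding the angles. [cite: Glazman2015WeightedSAW, Lemma 3.1 (proof: the phase factors e^{−iσ·winding})] -/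
private theorem exp_mul_I_mul_exp_mul_IFRL (a b : ℝ) :
    Complex.exp (((a : ℝ) : ℂ) * Complex.I) * Complex.exp (((b : ℝ) : ℂ) * Complex.I) =
      Complex.exp ((((a + b : ℝ)) : ℂ) * Complex.I) := by
  rw [← Complex.exp_add]; congr 1; push_cast; ring

/-- (Duplicated from `PlaquetteWalkHoleRootFarCellRoutes` for build reasons; that leaf is the citable home of (R1) and of the route algebra.) ★ **Over-route**: the prefix that passes over the hole and enters the far cell from `N` has total turning
`π + θ`; with the tree's `backBracket_N_W_S_E` the product `phase(WP) · backBracket` is the REAL number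
`−v(θ)`. [cite: Glazman2015WeightedSAW, Lemma 3.1, eq. (1) (the weight v(θ))] [cite: GlazmanManolescu2019, Lemma 2.1 (proof: [Gl])] -/
private theorem phase_over_mul_backBracket_N_W_S_EFRL (θ : ℝ) :
    phase (π + θ) * backBracket θ .N .W .S .E = -(weightV θ : ℂ) := by
  rw [backBracket_N_W_S_E, phase]
  rw [show Complex.exp ((((-(5 / 8 * (π + θ))) : ℝ) : ℂ) * Complex.I) *
      (-(weightV θ : ℂ) * Complex.exp (((5 * θ / 8 + 5 * π / 8 : ℝ) : ℂ) * Complex.I)) =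
      -(weightV θ : ℂ) * (Complex.exp ((((-(5 / 8 * (π + θ))) : ℝ) : ℂ) * Complex.I) *
        Complex.exp (((5 * θ / 8 + 5 * π / 8 : ℝ) : ℂ) * Complex.I)) by ring,
    exp_mul_I_mul_exp_mul_IFRL, show (-(5 / 8 * (π + θ)) + (5 * θ / 8 + 5 * π / 8) : ℝ) = 0 by ring]
  simp

/-- (Duplicated from `PlaquetteWalkHoleRootFarCellRoutes` for build reasons; that leaf is the citable home of (R1) and of the route algebra.) ★ **Under-route**: the prefix that passes under the hole and enters the far cell from `S` has total
turning `θ − 2π`; with `backBracket_S_W_N_E` the product is the same real number `−v(θ)`.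
[cite: Glazman2015WeightedSAW, Lemma 3.1, eq. (1) (the weight v(θ))] [cite: GlazmanManolescu2019, Lemma 2.1 (proof: [Gl])] -/
private theorem phase_under_mul_backBracket_S_W_N_EFRL (θ : ℝ) :
    phase (θ - 2 * π) * backBracket θ .S .W .N .E = -(weightV θ : ℂ) := by
  rw [backBracket_S_W_N_E, phase]
  rw [show Complex.exp ((((-(5 / 8 * (θ - 2 * π))) : ℝ) : ℂ) * Complex.I) *
      (-(weightV θ : ℂ) * Complex.exp (((5 * θ / 8 - 5 * π / 4 : ℝ) : ℂ) * Complex.I)) =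
      -(weightV θ : ℂ) * (Complex.exp ((((-(5 / 8 * (θ - 2 * π))) : ℝ) : ℂ) * Complex.I) *
        Complex.exp (((5 * θ / 8 - 5 * π / 4 : ℝ) : ℂ) * Complex.I)) by ring,
    exp_mul_I_mul_exp_mul_IFRL, show (-(5 / 8 * (θ - 2 * π)) + (5 * θ / 8 - 5 * π / 4) : ℝ) = 0 by ring]
  simp

/-- (Duplicated from `PlaquetteWalkHoleRootFarCellRoutes` for build reasons; that leaf is the citable home of (R1) and of the route algebra.) **The two routes agree**: `phase(π + θ) · backBracket θ N W S E = phase(θ − 2π) · backBracket θ S W N E` —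
the over- and under-route wound groups at the far cell point the same (real) way, so they can cancel only by
mass (the lane's (R-9′) mirror zeros). [cite: GlazmanManolescu2019, Lemma 2.1 (proof: [Gl])] -/
private theorem farCell_routes_agreeFRL (θ : ℝ) :
    phase (π + θ) * backBracket θ .N .W .S .E = phase (θ - 2 * π) * backBracket θ .S .W .N .E := by
  rw [phase_over_mul_backBracket_N_W_S_EFRL, phase_under_mul_backBracket_S_W_N_EFRL]

/-! ## The chord rule at a plaquette adjacent to the root's exterior face (the combinatorial input (R1))

For a class-`B2a` walk at a rhombus `r` one of whose sides `σ` is a side of the exterior face `g ∉ D` that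
carries the root `a` (a plaquette adjacent to the root's hole, `σ` its dead side): the winding angle of the
excursion polygon `J` is the same at the midpoint of the root, at the midpoint of the first side `z₀` (transport
along the prefix, parent file) and at the midpoint of the dead side `σ` (transport through `g`, below). The sign
rule of `YangBaxterSAWExcursionJordan` evaluates both as `0` or `2π · chordSign(·; z₁, z₂)`; so for a WOUND walk the
first side and the dead side lie on the same side of the chord: `chordSign(z₀; z₁, z₂) = chordSign(σ; z₁, z₂)`, and in
particular `z₀` is never the side opposite to `σ` — at the far cell no wound excursion belongs to a walk that first
reached the cell from the far side. -/

open private far_ctr far_midPt sdot_pJpt_of_far AJ_eq_AJ_of_sdot pJpt_cases' sdot_midPt_ctr_pos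
  from Literature.Probability.RandomPlanarGeometry.YangBaxterSAWGeneralDomain

/-- (Duplicated from `PlaquetteWalkHoleRootFarCellRoutes` for build reasons; that leaf is the citable home of (R1) and of the route algebra.) `x² + y² ≥ 5` from coordinate bounds. [cite: GlazmanManolescu2019, §1 (the lattice of rhombi and its mid-edges)] -/
private theorem five_le_sq_add_sqFRL {x y : ℤ}
    (h : (x ≤ -3 ∨ 3 ≤ x) ∨ (y ≤ -3 ∨ 3 ≤ y) ∨ ((x ≤ -2 ∨ 2 ≤ x) ∧ (y ≤ -1 ∨ 1 ≤ y)) ∨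
      ((y ≤ -2 ∨ 2 ≤ y) ∧ (x ≤ -1 ∨ 1 ≤ x))) : 5 ≤ x ^ 2 + y ^ 2 := by
  rcases h with (h | h) | (h | h) | ⟨h1 | h1, h2 | h2⟩ | ⟨h1 | h1, h2 | h2⟩ <;> nlinarith [sq_nonneg x, sq_nonneg y]

/-- (Duplicated from `PlaquetteWalkHoleRootFarCellRoutes` for build reasons; that leaf is the citable home of (R1) and of the route algebra.) An inner point of a face is at squared distance `≥ 5` from the midpoint of every edge other than the side it
sits next to. [cite: GlazmanManolescu2019, §1 (the lattice of rhombi and its mid-edges)] -/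
private theorem five_le_distSq_innerPt_midPt_of_neFRL {g : Face} {z : Side} {e : MidEdge} (h : g.side z ≠ e) :
    5 ≤ ((innerPt g z).1 - (midPt e).1) ^ 2 + ((innerPt g z).2 - (midPt e).2) ^ 2 := by
  obtain ⟨k, j⟩ := g
  refine five_le_sq_add_sqFRL ?_
  rcases e with ⟨k', j'⟩ | ⟨k', j'⟩ <;> cases z <;>
    simp [innerPt, Face.base, Side.inOff, Side.offset, Side.nIn, midPt, Face.side] at h ⊢ <;> omega

variable {D : Set Face} {a : MidEdge} {r : Face}

namespace YBWalk

/-- (Duplicated from `PlaquetteWalkHoleRootFarCellRoutes` for build reasons; that leaf is the citable home of (R1) and of the route algebra.) The `i`-th arc read through `nth`. [cite: GlazmanManolescu2019, §1 (the lattice of rhombi and its mid-edges)] -/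
private theorem arcFace_nth_eq_some_fcFRL {z : MidEdge} (γ : YBWalk D a z) {i : ℕ} (hi : i < γ.arcs.length) :
    arcFace (γ.nth i, γ.nth (i + 1)) = some (γ.fc i) := by
  have h1 := (YBWalk.arcFace_arcAt (γ := γ) hi).1
  have hl := γ.length_eq
  rwa [YBWalk.arcAt_eq hi, ← γ.nth_eq_getElem (by omega), ← γ.nth_eq_getElem (by omega)] at h1

end YBWalk

namespace ΩG

variable {ω : ΩG D a r} (hr : RootedFace D a r)

/-- (Duplicated from `PlaquetteWalkHoleRootFarCellRoutes` for build reasons; that leaf is the citable home of (R1) and of the route algebra.) **`J` stays `≥ 5` (squared) away from the midpoint of a dead side**: if the side `σ` of `r` is neither the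
exit nor the return side and its other face `g` lies outside the domain, every vertex of the excursion polygon is
at squared distance `≥ 5` from `midPt (r.side σ)` (the vertices are inner points of excursion faces — in `D`,
not `r`, hence not faces of that edge — or the two chord ends `innerPt r z₁`, `innerPt r z₂`).
[cite: Glazman2015WeightedSAW, Lemma 3.1 (proof: the winding of the grouped walks)] -/
private theorem five_le_distSq_pJpt_midPt_deadFRL (h : ω.IsB2a) {σ : Side} (hσ1 : σ ≠ ω.z1 hr h) (hσ2 : σ ≠ ω.1)
    {g : Face} (hg : g ∉ D) (hgr : g ≠ r) {s : Side} (hgs : g.side s = r.side σ) {k : ℕ} (hk : k ≤ 2 * ω.Mv) :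
    5 ≤ ((ω.pJpt hr h k).1 - (midPt (r.side σ)).1) ^ 2 + ((ω.pJpt hr h k).2 - (midPt (r.side σ)).2) ^ 2 := by
  -- the two faces of the edge `r.side σ` are `r` and `g`
  have faces_of_edge : ∀ f : Face, (∃ t, f.side t = r.side σ) → f = r ∨ f = g := by
    intro f hf
    have hr' := (Face.exists_side_eq_iff r (r.side σ)).1 ⟨σ, rfl⟩
    have hg' := (Face.exists_side_eq_iff g (r.side σ)).1 ⟨s, hgs⟩
    have hf' := (Face.exists_side_eq_iff f (r.side σ)).1 hf
    rcases hf' with e | e <;> rcases hr' with e1 | e1 <;> rcases hg' with e2 | e2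
    all_goals first
      | exact Or.inl (e.trans e1.symm)
      | exact Or.inr (e.trans e2.symm)
      | exact absurd (e1.trans e2.symm) hgr.symm
  rcases pJpt_cases' (ω := ω) (hr := hr) h hk with ⟨i, hi1, hi2, e | e⟩ | e | e
  · rw [e]
    refine five_le_distSq_innerPt_midPt_of_neFRL fun hh => ?_
    have hD := (YBWalk.arcFace_arcAt (γ := ω.2) hi2).2
    rcases faces_of_edge _ ⟨_, hh⟩ with e1 | e1
    · exact YBWalk.arcFace_ne_of_excursionG (γ := ω.2) hr h.1 hi1 (by rw [h.2]; exact hi2)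
        (by rw [ω.2.arcFace_nth_eq_some_fcFRL hi2, e1])
    · exact hg (e1 ▸ hD)
  · rw [e]
    refine five_le_distSq_innerPt_midPt_of_neFRL fun hh => ?_
    have hD := (YBWalk.arcFace_arcAt (γ := ω.2) hi2).2
    rcases faces_of_edge _ ⟨_, hh⟩ with e1 | e1
    · exact YBWalk.arcFace_ne_of_excursionG (γ := ω.2) hr h.1 hi1 (by rw [h.2]; exact hi2)
        (by rw [ω.2.arcFace_nth_eq_some_fcFRL hi2, e1])
    · exact hg (e1 ▸ hD)
  · rw [e]; exact five_le_distSq_innerPt_midPt_of_neFRL fun hh => hσ1 (Face.side_injective r hh).symm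
  · rw [e]; exact five_le_distSq_innerPt_midPt_of_neFRL fun hh => hσ2 (Face.side_injective r hh).symm

/-- (Duplicated from `PlaquetteWalkHoleRootFarCellRoutes` for build reasons; that leaf is the citable home of (R1) and of the route algebra.) **Transport from the midpoint of a dead side to the centre of the exterior face behind it.**
[cite: Glazman2015WeightedSAW, Lemma 3.1 (proof: the winding of the grouped walks)] -/
private theorem AJ_midPt_dead_eq_AJ_ctrFRL (h : ω.IsB2a) {σ : Side} (hσ1 : σ ≠ ω.z1 hr h) (hσ2 : σ ≠ ω.1)
    {g : Face} (hg : g ∉ D) {s : Side} (hgs : g.side s = r.side σ) :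
    ω.AJ hr h (toC (midPt (r.side σ))) = ω.AJ hr h (toC (Face.ctr g)) := by
  have hgr : g ≠ r := fun e => hg (e ▸ hr.mem)
  refine AJ_eq_AJ_of_sdot (ω := ω) (hr := hr) h _ _ (fun k hk => ?_) (fun k hk => ?_) (fun k hk => ?_)
  · exact sdot_pJpt_of_far (ω := ω) (hr := hr) h _
      (fun k' hk' => five_le_distSq_pJpt_midPt_deadFRL hr h hσ1 hσ2 hg hgr hgs hk') hk
  · exact sdot_pJpt_of_far (ω := ω) (hr := hr) h _
      (fun k' hk' => le_trans (by norm_num) (far_ctr (ω := ω) (hr := hr) h hg hk')) hk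
  · have hz := sdot_midPt_ctr_pos g s (far_ctr (ω := ω) (hr := hr) h hg hk) (far_midPt (ω := ω) (hr := hr) h (g.side s) hk)
    rw [hgs] at hz
    exact hz

/-- (Duplicated from `PlaquetteWalkHoleRootFarCellRoutes` for build reasons; that leaf is the citable home of (R1) and of the route algebra.) The winding of `J` at the midpoint of the first side equals its winding at the root (the parent file's
transport along the prefix, in `midPt` form). [cite: Glazman2015WeightedSAW, Lemma 3.1 (proof: the winding of the grouped walks)] -/
private theorem AJ_midPt_firstSide_eq_AJ_rootFRL (h : ω.IsB2a) :
    ω.AJ hr h (toC (midPt (r.side ω.2.firstSideG))) = ω.AJ hr h (toC (midPt a)) := by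
  rw [← ω.AJ_qQ_zero_eq_AJ_root (hr := hr) (h := h), ΩG.qQ, ω.Qp_zero (hr := hr) h, midPt_side]

/-- (Duplicated from `PlaquetteWalkHoleRootFarCellRoutes` for build reasons; that leaf is the citable home of (R1) and of the route algebra.) ★★ **The chord rule at a plaquette adjacent to the root's hole.** If the dead side `σ` of `r` (neither exit
nor return side) is a side of an exterior face `g ∉ D` that also carries the root `a`, then for every WOUND walk of
class `B2a` at `r` the first side `z₀` and the dead side `σ` lie on the same side of the chord:
`chordSign(z₀; z₁, z₂) = chordSign(σ; z₁, z₂)`. [cite: GlazmanManolescu2019, Lemma 2.1 (proof: [Gl])]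
[cite: Glazman2015WeightedSAW, Lemma 3.1 (proof, pp. 6–7: the classes of walks through a rhombus)]
[cite: DuminilCopinSmirnov2012, proof of Lemma 1 (the winding bookkeeping)] -/
private theorem chordSign_firstSide_eq_chordSign_deadFRL (h : ω.IsB2a) {σ : Side} (hσ1 : σ ≠ ω.z1 hr h) (hσ2 : σ ≠ ω.1)
    {g : Face} (hg : g ∉ D) {s s' : Side} (hgs : g.side s = r.side σ) (hga : g.side s' = a)
    (hw : ω.AJ hr h (toC (midPt a)) ≠ 0) :
    chordSign ω.2.firstSideG (ω.z1 hr h) ω.1 = chordSign σ (ω.z1 hr h) ω.1 := by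
  have hd := ω.2.sides_distinctG hr h.1
  rw [ω.returnSide_of_isB2a h] at hd
  have hz01 : ω.2.firstSideG ≠ ω.z1 hr h := by unfold ΩG.z1; exact fun e => hd.1 e.symm
  have hz02 : ω.2.firstSideG ≠ ω.1 := fun e => hd.2.1 e.symm
  -- the winding at the first side is the winding at the root
  have h0 := ω.AJ_midPt_firstSide_eq_AJ_rootFRL hr h
  -- the winding at the dead side is the winding at the root (through `g`)
  have hσ := (ω.AJ_midPt_dead_eq_AJ_ctrFRL hr h hσ1 hσ2 hg hgs).trans (ω.AJ_root_eq_AJ_ctr (hr := hr) h hg hga).symm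
  -- the sign rule at both midpoints
  rcases ω.AJ_midPt_side_eq (hr := hr) h hz01 hz02 with e0 | e0
  · exact absurd (h0 ▸ e0) hw
  rcases ω.AJ_midPt_side_eq (hr := hr) h hσ1 hσ2 with e1 | e1
  · exact absurd (hσ ▸ e1) hw
  have key : (2 * Real.pi * (chordSign ω.2.firstSideG (ω.z1 hr h) ω.1 : ℝ)) =
      2 * Real.pi * (chordSign σ (ω.z1 hr h) ω.1 : ℝ) := by
    rw [← e0, ← e1, h0, hσ]
  have h2 : (2 * Real.pi : ℝ) ≠ 0 := mul_ne_zero two_ne_zero Real.pi_ne_zero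
  exact_mod_cast mul_left_cancel₀ h2 key

/-- (Duplicated from `PlaquetteWalkHoleRootFarCellRoutes` for build reasons; that leaf is the citable home of (R1) and of the route algebra.) Opposite sides lie on opposite sides of the chord joining the inner points of the two remaining sides.
[cite: GlazmanManolescu2019, §1 (the lattice of rhombi and its mid-edges)] -/
private theorem chordSign_opp_neFRL : ∀ σ z₁ z₂ : Side, z₁ ≠ σ → z₁ ≠ σ.opp → z₂ ≠ σ → z₂ ≠ σ.opp → z₁ ≠ z₂ →
    chordSign σ.opp z₁ z₂ ≠ chordSign σ z₁ z₂ := by decide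

/-- (Duplicated from `PlaquetteWalkHoleRootFarCellRoutes` for build reasons; that leaf is the citable home of (R1) and of the route algebra.) ★★ **No wound excursion after a far-side entry**: in the situation of the chord rule the walk did not first
reach `r` through the side opposite to the dead side. At the far cell of a hole root (dead side towards the hole)
this is the lane's rigidity (R1): a wound class-`B2a` walk enters the far cell from a lateral side, never from
the far side. [cite: GlazmanManolescu2019, Lemma 2.1 (proof: [Gl])]
[cite: Glazman2015WeightedSAW, Lemma 3.1 (proof, pp. 6–7: the classes of walks through a rhombus)] -/
private theorem firstSide_ne_opp_of_woundFRL (h : ω.IsB2a) {σ : Side} (hσ1 : σ ≠ ω.z1 hr h) (hσ2 : σ ≠ ω.1)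
    {g : Face} (hg : g ∉ D) {s s' : Side} (hgs : g.side s = r.side σ) (hga : g.side s' = a)
    (hw : ω.AJ hr h (toC (midPt a)) ≠ 0) : ω.2.firstSideG ≠ σ.opp := by
  intro hopp
  have hd := ω.2.sides_distinctG hr h.1
  rw [ω.returnSide_of_isB2a h] at hd
  have hz1 : ω.z1 hr h ≠ σ.opp := by unfold ΩG.z1; rw [← hopp]; exact hd.1
  have hz2 : ω.1 ≠ σ.opp := by rw [← hopp]; exact hd.2.1
  have hz12 : ω.z1 hr h ≠ ω.1 := by unfold ΩG.z1; exact fun e => hd.2.2 e.symm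
  have key := ω.chordSign_firstSide_eq_chordSign_deadFRL hr h hσ1 hσ2 hg hgs hga hw
  rw [hopp] at key
  exact chordSign_opp_neFRL σ (ω.z1 hr h) ω.1 (Ne.symm hσ1) hz1 (Ne.symm hσ2) hz2 hz12 key

/-- (Duplicated from `PlaquetteWalkHoleRootFarCellRoutes` for build reasons; that leaf is the citable home of (R1) and of the route algebra.) Two distinct faces of the domain with a common side make that side a door (both its faces in `D`).
[cite: GlazmanManolescu2019, §1 (the lattice of rhombi and its mid-edges)] -/
private theorem door_of_two_facesFRL {e : MidEdge} {f f' : Face} (hf : ∃ s, f.side s = e) (hf' : ∃ s, f'.side s = e)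
    (hne : f ≠ f') (hD : f ∈ D) (hD' : f' ∈ D) : e.faces.1 ∈ D ∧ e.faces.2 ∈ D := by
  rcases (Face.exists_side_eq_iff f e).1 hf with h1 | h1 <;> rcases (Face.exists_side_eq_iff f' e).1 hf' with h2 | h2
  · exact absurd (h1.trans h2.symm) hne
  · exact ⟨h1 ▸ hD, h2 ▸ hD'⟩
  · exact ⟨h2 ▸ hD', h1 ▸ hD⟩
  · exact absurd (h1.trans h2.symm) hne

/-- (Duplicated from `PlaquetteWalkHoleRootFarCellRoutes` for build reasons; that leaf is the citable home of (R1) and of the route algebra.) ★ **The first side is never the dead side** (unless the root itself is a side of `r`): the first hit of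
`∂r` by a class-`B2a` walk is a crossed mid-edge — the exit of the previous arc (in a face of `D` other than `r`)
and the entry of the arc inside `r` — hence a door, whereas the dead side `σ` has the exterior face `g ∉ D`
behind it. [cite: Glazman2015WeightedSAW, Lemma 3.1 (proof, pp. 6–7: the classes of walks through a rhombus)] -/
private theorem firstSide_ne_deadFRL (hr : RootedFace D a r) (h : ω.IsB2a) {σ : Side} {g : Face} (hg : g ∉ D) {s : Side}
    (hgs : g.side s = r.side σ) (hra : ∀ t : Side, r.side t ≠ a) : ω.2.firstSideG ≠ σ := by
  intro hz
  set γ := ω.2 with hγ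
  have hfh : γ.firstHitG < γ.arcs.length := ω.fh_lt h
  have hnth := γ.nth_firstHitG
  rw [hz] at hnth
  rcases Nat.eq_zero_or_pos γ.firstHitG with h0 | hpos
  · rw [h0, γ.nth_zero] at hnth
    exact hra σ hnth.symm
  · -- the arc before the first hit lies in a face of `D` other than `r`, the arc at the first hit in `r`
    have hl := γ.length_eq
    obtain ⟨-, hout, -⟩ := YBWalk.side_sIn (γ := γ) (i := γ.firstHitG - 1) (by omega)
    rw [← γ.nth_eq_getElem (by omega), show γ.firstHitG - 1 + 1 = γ.firstHitG by omega, hnth] at hout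
    have hDprev := (YBWalk.arcFace_arcAt (γ := γ) (i := γ.firstHitG - 1) (by omega)).2
    have hne : γ.fc (γ.firstHitG - 1) ≠ r := by
      intro e
      have h1 := γ.arcFace_nth_eq_some_fcFRL (i := γ.firstHitG - 1) (by omega)
      rw [e] at h1
      exact YBWalk.arcFace_ne_of_lt_firstHitG (γ := γ) (i := γ.firstHitG - 1) (by omega) (by omega) h1
    have hdoor := door_of_two_facesFRL (D := D) ⟨_, hout⟩ ⟨σ, rfl⟩ hne hDprev hr.mem
    -- but `g ∉ D` is a face of that edge
    rcases (Face.exists_side_eq_iff g (r.side σ)).1 ⟨s, hgs⟩ with e | e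
    · exact hg (e ▸ hdoor.1)
    · exact hg (e ▸ hdoor.2)

/-- (Duplicated from `PlaquetteWalkHoleRootFarCellRoutes` for build reasons; that leaf is the citable home of (R1) and of the route algebra.) ★★ **At a hole-adjacent plaquette a wound excursion belongs to a walk that entered through a LATERAL side**:
the first side is neither the dead side nor the side opposite to it. (At the far cell of a hole root: `z₀ ∈ {N, S}`
in the `W`-root normalisation — the lane's two routes, over and under the hole.)
[cite: GlazmanManolescu2019, Lemma 2.1 (proof: [Gl])] [cite: Glazman2015WeightedSAW, Lemma 3.1 (proof, pp. 6–7)] -/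
private theorem firstSide_lateral_of_woundFRL (h : ω.IsB2a) {σ : Side} (hσ1 : σ ≠ ω.z1 hr h) (hσ2 : σ ≠ ω.1)
    {g : Face} (hg : g ∉ D) {s s' : Side} (hgs : g.side s = r.side σ) (hga : g.side s' = a)
    (hra : ∀ t : Side, r.side t ≠ a) (hw : ω.AJ hr h (toC (midPt a)) ≠ 0) :
    ω.2.firstSideG ≠ σ ∧ ω.2.firstSideG ≠ σ.opp :=
  ⟨ω.firstSide_ne_deadFRL hr h hg hgs hra, ω.firstSide_ne_opp_of_woundFRL hr h hσ1 hσ2 hg hgs hga hw⟩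

end ΩG

end Literature.Probability.RandomPlanarGeometry.SAW.YangBaxter

end

noncomputable section

namespace Literature.Probability.RandomPlanarGeometry.SAW.YangBaxter

open Real Complex

/-! ## Private lattice tools (copies of the far-cell file's private helpers) -/

section Tools

/-- `dsq` is symmetric. [folklore] -/
private theorem dsq_comm' (p q : ℤ × ℤ) : dsq p q = dsq q p := by unfold dsq; ring

/-- Polarization. [folklore] -/
private theorem two_mul_sdot' (A B v : ℤ × ℤ) : 2 * sdot A B v = dsq A v + dsq B v - dsq A B := by
  unfold sdot dsq; ring

/-- Distinct lattice points are at squared distance `≥ 1`. [folklore] -/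
private theorem one_le_dsq_of_ne' {p q : ℤ × ℤ} (h : p ≠ q) : 1 ≤ dsq p q := by
  unfold dsq
  by_contra hlt
  push Not at hlt
  have h1 : (p.1 - q.1) ^ 2 = 0 := by nlinarith [sq_nonneg (p.1 - q.1), sq_nonneg (p.2 - q.2)]
  have h2 : (p.2 - q.2) ^ 2 = 0 := by nlinarith [sq_nonneg (p.1 - q.1), sq_nonneg (p.2 - q.2)]
  exact h (Prod.ext (by nlinarith [pow_eq_zero_iff (n := 2) (a := p.1 - q.1) two_ne_zero])
    (by nlinarith [pow_eq_zero_iff (n := 2) (a := p.2 - q.2) two_ne_zero]))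

/-- The acute-angle test from distances. [folklore] -/
private theorem sdot_pos_of_dsq' {A B v : ℤ × ℤ} (h : dsq A B < dsq A v + dsq B v) : 0 < sdot A B v := by
  have := two_mul_sdot' A B v; omega

/-- `|x| ≥ 2 ⇒ x² ≥ 4`. [folklore] -/
private theorem four_le_sq_of_two_le' {x : ℤ} (h : 2 ≤ x ∨ x ≤ -2) : 4 ≤ x ^ 2 := by
  rcases h with h | h <;> nlinarith

/-- The inner offsets lie in `{1,2,3}²`. [folklore] -/
private theorem inOff_bounds' (s : Side) : 1 ≤ s.inOff.1 ∧ s.inOff.1 ≤ 3 ∧ 1 ≤ s.inOff.2 ∧ s.inOff.2 ≤ 3 := by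
  cases s <;> simp [Side.inOff, Side.offset, Side.nIn]

/-- The inward normals are unit lattice vectors. [folklore] -/
private theorem nIn_bounds' (s : Side) : -1 ≤ s.nIn.1 ∧ s.nIn.1 ≤ 1 ∧ -1 ≤ s.nIn.2 ∧ s.nIn.2 ≤ 1 ∧ s.nIn.1 ^ 2 + s.nIn.2 ^ 2 = 1 := by
  cases s <;> simp [Side.nIn]

/-- Coordinates (vertical pair of excluded faces). [folklore] -/
private theorem four_le_of_coords_v {k j k' j' ox oy cx cy : ℤ} (hox : 1 ≤ ox ∧ ox ≤ 3) (hoy : 1 ≤ oy ∧ oy ≤ 3)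
    (hcx : 1 ≤ cx ∧ cx ≤ 3) (hcy : 1 ≤ cy ∧ cy ≤ 7) (hne : ¬(k = k' ∧ j = j')) (hne' : ¬(k = k' ∧ j = j' + 1)) :
    4 ≤ (4 * k + ox - (4 * k' + cx)) ^ 2 + (4 * j + oy - (4 * j' + cy)) ^ 2 := by
  by_cases hk : k = k'
  · subst hk
    have hj : j ≠ j' := fun e => hne ⟨rfl, e⟩
    have hj' : j ≠ j' + 1 := fun e => hne' ⟨rfl, e⟩
    have h3 : 2 ≤ (4 * j + oy - (4 * j' + cy)) ∨ (4 * j + oy - (4 * j' + cy)) ≤ -2 := by omega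
    nlinarith [four_le_sq_of_two_le' h3, sq_nonneg (4 * k + ox - (4 * k + cx))]
  · have h3 : 2 ≤ (4 * k + ox - (4 * k' + cx)) ∨ (4 * k + ox - (4 * k' + cx)) ≤ -2 := by omega
    nlinarith [four_le_sq_of_two_le' h3, sq_nonneg (4 * j + oy - (4 * j' + cy))]

/-- ★ An inner point of a face `g ∉ {f, N-neighbour of f}` is at squared distance `≥ 4` from every point of the
column `f.base + [1,3] × [1,7]`. [folklore] -/
private theorem four_le_dsq_innerPt_v {g f : Face} (hg : g ≠ f) (hg' : g ≠ (f.1, f.2 + 1)) (s : Side) {cx cy : ℤ}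
    (hcx : 1 ≤ cx ∧ cx ≤ 3) (hcy : 1 ≤ cy ∧ cy ≤ 7) : 4 ≤ dsq (innerPt g s) (f.base + (cx, cy)) := by
  obtain ⟨k, j⟩ := g
  obtain ⟨k', j'⟩ := f
  have hb := inOff_bounds' s
  have hne : ¬(k = k' ∧ j = j') := fun e => hg (Prod.ext e.1 e.2)
  have hne' : ¬(k = k' ∧ j = j' + 1) := fun e => hg' (Prod.ext e.1 e.2)
  simp only [dsq, innerPt, Face.base, Prod.fst_add, Prod.snd_add]
  exact four_le_of_coords_v ⟨hb.1, hb.2.1⟩ ⟨hb.2.2.1, hb.2.2.2⟩ hcx hcy hne hne'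

/-- Two faces sharing a side: the sides are opposite. [folklore] -/
private theorem side_eq_opp_of_side_eq' {g f : Face} {s t : Side} (h : g.side s = f.side t) (hg : g ≠ f) : s = t.opp := by
  obtain ⟨k, j⟩ := g
  obtain ⟨k', j'⟩ := f
  have hne : ¬(k = k' ∧ j = j') := fun e => hg (Prod.ext e.1 e.2)
  cases s <;> cases t <;>
    simp only [Face.side, MidEdge.vert.injEq, MidEdge.slant.injEq, reduceCtorEq, Side.opp] at h ⊢ <;> omega

/-- `dsq` is translation invariant. [folklore] -/
private theorem dsq_add_left' (b u v : ℤ × ℤ) : dsq (b + u) (b + v) = dsq u v := by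
  simp only [dsq, Prod.fst_add, Prod.snd_add]; ring

/-- Squared length of a step. [folklore] -/
private theorem dsq_self_add' (m n : ℤ × ℤ) : dsq m (m + n) = n.1 ^ 2 + n.2 ^ 2 := by
  simp only [dsq, Prod.fst_add, Prod.snd_add]; ring

/-- Two inner offsets are at squared distance `≤ 4`. [folklore] -/
private theorem dsq_inOff_le' (s t : Side) : dsq s.inOff t.inOff ≤ 4 := by
  cases s <;> cases t <;> simp [dsq, Side.inOff, Side.offset, Side.nIn]

/-- Two inward normals are at squared distance `≤ 4`. [folklore] -/
private theorem dsq_nIn_le' (s t : Side) : dsq s.nIn t.nIn ≤ 4 := by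
  cases s <;> cases t <;> simp [dsq, Side.nIn]

/-- Opposite sides have opposite inward normals. [folklore] -/
private theorem nIn_opp' (s : Side) : s.opp.nIn = -s.nIn := by
  cases s <;> simp [Side.opp, Side.nIn]

/-- `opp` is an involution. [folklore] -/
private theorem side_opp_opp' (s : Side) : s.opp.opp = s := by cases s <;> rfl

/-- Consecutive vertices of a walk polyline are at squared distance `≤ 4`. [folklore] -/
private theorem dsq_vtx_succ_le' {D : Set Face} {a z : MidEdge} (γ : YBWalk D a z) {k : ℕ} (hk : k ≤ 2 * γ.arcs.length) :
    dsq (γ.vtx k) (γ.vtx (k + 1)) ≤ 4 := by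
  have hlen := γ.length_eq
  rcases YBWalk.index_cases (γ := γ) k (by omega) with rfl | ⟨i, hi, rfl⟩ | ⟨i, hi, rfl⟩ | h0
  · rcases Nat.eq_zero_or_pos γ.arcs.length with h0 | hpos
    · rw [YBWalk.vtx_zero, show (0 : ℕ) + 1 = 2 * γ.arcs.length + 1 by omega, YBWalk.vtx_last]
      have : a = z := by
        have e := γ.nth_length; rw [h0, γ.nth_zero] at e; exact e
      subst this; simp [dsq]
    · rw [YBWalk.vtx_zero, show (0 : ℕ) + 1 = 2 * 0 + 1 from rfl, YBWalk.vtx_odd hpos, YBWalk.ptIn, innerPt_eq,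
        (YBWalk.side_sIn hpos).1, ← γ.nth_eq_getElem (by omega), γ.nth_zero, dsq_self_add']
      have hb := nIn_bounds' (γ.sIn 0)
      omega
  · rw [YBWalk.vtx_odd hi, show 2 * i + 1 + 1 = 2 * i + 2 by ring, YBWalk.vtx_even hi, YBWalk.ptIn, YBWalk.ptOut,
      innerPt, innerPt, dsq_add_left']
    exact dsq_inOff_le' _ _
  · rcases Nat.lt_or_ge (i + 1) γ.arcs.length with hlt | hge
    · rw [YBWalk.vtx_even hi, show 2 * i + 2 + 1 = 2 * (i + 1) + 1 by ring, YBWalk.vtx_odd hlt, YBWalk.ptIn,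
        YBWalk.ptOut, innerPt_eq, innerPt_eq, (YBWalk.side_sIn hi).2.1, (YBWalk.side_sIn hlt).1, dsq_add_left']
      exact dsq_nIn_le' _ _
    · have hi' : i + 1 = γ.arcs.length := by omega
      rw [YBWalk.vtx_even hi, show 2 * i + 2 + 1 = 2 * γ.arcs.length + 1 by omega, YBWalk.vtx_last, YBWalk.ptOut,
        innerPt_eq, (YBWalk.side_sIn hi).2.1, ← γ.nth_eq_getElem (by omega), hi', γ.nth_length, dsq_comm',
        dsq_self_add']
      have hb := nIn_bounds' (γ.sOut i)
      omega
  · omega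

/-- `arg x = 0` for a positive real lattice vector. [folklore] -/
private theorem arg_toC_pos_zero' {x : ℤ} (hx : 0 < x) : Complex.arg (toC (x, 0)) = 0 := by
  rw [toC_mk]; push_cast; simp only [zero_mul, add_zero]
  exact_mod_cast Complex.arg_ofReal_of_nonneg (by exact_mod_cast hx.le)

/-- `arg (−x) = π` for `x > 0`. [folklore] -/
private theorem arg_toC_neg_zero' {x : ℤ} (hx : 0 < x) : Complex.arg (toC (-x, 0)) = π := by
  rw [toC_mk]; push_cast; simp only [zero_mul, add_zero]
  rw [show -(x : ℂ) = ((-(x : ℝ) : ℝ) : ℂ) by push_cast; ring]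
  have hx' : (0 : ℝ) < x := by exact_mod_cast hx
  exact Complex.arg_ofReal_of_neg (by linarith)

/-- `arg (−y i) = −π/2` for `y > 0`. [folklore] -/
private theorem arg_toC_zero_neg' {y : ℤ} (hy : 0 < y) : Complex.arg (toC (0, -y)) = -(π / 2) := by
  rw [toC_mk]; push_cast; simp only [zero_add]
  rw [show -(y : ℂ) * Complex.I = ((y : ℝ) : ℂ) * (-Complex.I) by push_cast; ring,
    Complex.arg_real_mul _ (by exact_mod_cast hy), Complex.arg_neg_I]

/-- `arg (1 − i) = −π/4`, `arg (−1 − i) = −3π/4` in `toC` form. [folklore] -/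
private theorem arg_toC_one_neg_one' : Complex.arg (toC ((1 : ℤ), (-1 : ℤ))) = -(π / 4) := by
  rw [toC_mk]; push_cast; rw [show (1 : ℂ) + -1 * Complex.I = 1 - Complex.I by ring]; exact arg_one_sub_I

/-- `arg (−1 − i) = −3π/4` in `toC` form. [folklore] -/
private theorem arg_toC_neg_one_neg_one' : Complex.arg (toC ((-1 : ℤ), (-1 : ℤ))) = -(3 * π / 4) := by
  rw [toC_mk]; push_cast; rw [show (-1 : ℂ) + -1 * Complex.I = -1 - Complex.I by ring]; exact arg_neg_one_sub_I

/-- Evaluation of an exterior angle from the two arguments. [folklore] -/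
private theorem toReal_sub_coe' {x y r : ℝ} (h : x - y = r) (hr : -π < r ∧ r ≤ π) :
    ((x : Real.Angle) - (y : Real.Angle)).toReal = r := by
  rw [← Real.Angle.coe_sub, h]; exact Real.Angle.toReal_coe_eq_self_iff.2 hr

/-- Evaluation of an exterior angle whose raw difference is below `−π`. [folklore] -/
private theorem toReal_sub_coe_add' {x y r : ℝ} (h : x - y + 2 * π = r) (hr : -π < r ∧ r ≤ π) :
    ((x : Real.Angle) - (y : Real.Angle)).toReal = r := by
  rw [← Real.Angle.coe_sub, show x - y = r - 2 * π by linarith, Real.Angle.coe_sub, Real.Angle.coe_two_pi, sub_zero]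
  exact Real.Angle.toReal_coe_eq_self_iff.2 hr

/-- `toC` of the difference of two translates. [folklore] -/
private theorem toC_add_sub_add' (b u v : ℤ × ℤ) : toC (b + u) - toC (b + v) = toC (u - v) := by
  rw [← toC_sub, add_sub_add_left_eq_sub]

end Tools

/-! ## The lateral cell north of the hole -/

section LateralCoords

variable (w : Face)

/-- The lateral cell NORTH of the hole of the root `w.side W`. [cite: GlazmanManolescu2019, §1 (the lattice of rhombi and its mid-edges)] -/
def latN (w : Face) : Face := (w.1 - 1, w.2 + 1)

/-- The lateral cell is the `N`-neighbour of the hole. [cite: GlazmanManolescu2019, §1 (the lattice of rhombi and its mid-edges)] -/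
theorem latN_eq : latN w = ((holeFaceW w).1, (holeFaceW w).2 + 1) := by
  obtain ⟨k, j⟩ := w; rfl

/-- The dead side of the lateral cell is the `N` side of the hole. [cite: GlazmanManolescu2019, §1 (the lattice of rhombi and its mid-edges)] -/
theorem holeFaceW_side_N : (holeFaceW w).side .N = (latN w).side .S := by
  obtain ⟨k, j⟩ := w; simp [holeFaceW, latN, Face.side]

/-- The root is not a side of the lateral cell. [cite: GlazmanManolescu2019, §1 (the lattice of rhombi and its mid-edges)] -/
theorem latN_side_ne_root (t : Side) : (latN w).side t ≠ w.side .W := by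
  obtain ⟨k, j⟩ := w
  intro h
  cases t <;> simp only [latN, Face.side, MidEdge.vert.injEq, reduceCtorEq] at h <;> omega

/-- The two faces of the dead side of the lateral cell are the hole and the lateral cell.
[cite: GlazmanManolescu2019, §1 (the lattice of rhombi and its mid-edges)] -/
theorem latN_side_S_faces : ((latN w).side .S).faces = (holeFaceW w, latN w) := by
  obtain ⟨k, j⟩ := w
  simp [latN, holeFaceW, Face.side, MidEdge.faces]

/-- The lateral cell's base in hole coordinates. [cite: GlazmanManolescu2019, §1 (the lattice of rhombi and its mid-edges)] -/
theorem latN_base : (latN w).base = (holeFaceW w).base + (0, 4) := by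
  obtain ⟨k, j⟩ := w
  refine Prod.ext ?_ ?_
  · show 4 * (k - 1) = 4 * (k - 1) + 0
    omega
  · show 4 * (j + 1) = 4 * j + 4
    omega

/-- The root midpoint in hole coordinates: `(holeFaceW w).base + (4, 2)`. [cite: GlazmanManolescu2019, §1 (the lattice of rhombi and its mid-edges)] -/
theorem midPt_root_eq_hole : midPt (w.side .W) = (holeFaceW w).base + (4, 2) := by
  obtain ⟨k, j⟩ := w
  refine Prod.ext ?_ ?_
  · show 4 * k = 4 * (k - 1) + 4
    omega
  · show 4 * j + 2 = 4 * j + 2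
    rfl

/-- Side midpoints of the lateral cell in hole coordinates. [cite: GlazmanManolescu2019, §1 (the lattice of rhombi and its mid-edges)] -/
theorem midPt_latN_side (s : Side) : midPt ((latN w).side s) = (holeFaceW w).base + ((0, 4) + s.offset) := by
  rw [midPt_side, latN_base, add_assoc]

/-- The lateral cell seen from the hole root is a rooted face. [cite: GlazmanManolescu2019, §2.1 (walks start on the boundary of the domain)] -/
theorem rootedFace_latN {D : Set Face} {w : Face} (hf : latN w ∈ D) (hh : holeFaceW w ∉ D) :
    RootedFace D (w.side .W) (latN w) :=
  ⟨hf, fun hb => hh (by rw [root_faces_W] at hb; exact hb.1)⟩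

end LateralCoords

end Literature.Probability.RandomPlanarGeometry.SAW.YangBaxter

namespace Literature.Probability.RandomPlanarGeometry.SAW.YangBaxter

open Real Complex

namespace ΩG

variable {D : Set Face} {w : Face}

section PrefixL

variable (ω : ΩG D (w.side .W) (latN w))

/-- The PREFIX of a class-`B2a` walk at the lateral cell: its first `firstHitG` arcs.
[cite: Glazman2015WeightedSAW, Lemma 3.1 (proof, pp. 6–7: the classes of walks through a rhombus)] -/
def preL (h : ω.IsB2a) : YBWalk D (w.side .W) (ω.2.nth ω.2.firstHitG) :=
  ω.2.take ω.2.firstHitG (ω.fh_lt h).le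

variable {ω}

/-- The prefix has `firstHitG` arcs. [folklore] -/
private theorem preL_length (h : ω.IsB2a) : (ω.preL h).arcs.length = ω.2.firstHitG := YBWalk.take_length _ _ _

/-- The mid-edges of the prefix. [folklore] -/
private theorem preL_nth (h : ω.IsB2a) {i : ℕ} (hi : i ≤ ω.2.firstHitG) : (ω.preL h).nth i = ω.2.nth i :=
  YBWalk.take_nth _ _ _ hi

/-- **The turning of the prefix is `WP`.** [cite: GlazmanManolescu2019, Lemma 2.1 (proof: [Gl])] -/
theorem preL_winding (h : ω.IsB2a) (Θ : ℤ → ℝ) : (ω.preL h).winding Θ = ω.WP Θ := by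
  unfold YBWalk.winding ΩG.WP
  rw [preL, YBWalk.take_arcs]

/-- The prefix is not empty. [folklore] -/
private theorem fhL_pos (ω : ΩG D (w.side .W) (latN w)) : 0 < ω.2.firstHitG := by
  by_contra h0
  push Not at h0
  have e := ω.2.nth_firstHitG
  rw [Nat.le_zero.1 h0, ω.2.nth_zero] at e
  exact latN_side_ne_root w _ e.symm

/-- The faces of the prefix arcs lie in the domain and are neither the lateral cell nor the hole.
[cite: Glazman2015WeightedSAW, Lemma 3.1 (proof, pp. 6–7)] -/
theorem preL_fc (hh : holeFaceW w ∉ D) (h : ω.IsB2a) {i : ℕ} (hi : i < ω.2.firstHitG) :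
    (ω.preL h).fc i ∈ D ∧ (ω.preL h).fc i ≠ latN w ∧ (ω.preL h).fc i ≠ holeFaceW w := by
  have hlen := preL_length (ω := ω) h
  have hD := (YBWalk.arcFace_arcAt (γ := ω.preL h) (i := i) (by rw [hlen]; exact hi)).2
  refine ⟨hD, fun e => ?_, fun e => hh (e ▸ hD)⟩
  have h1 := (ω.preL h).arcFace_nth_eq_some_fcFRL (i := i) (by rw [hlen]; exact hi)
  rw [preL_nth h hi.le, preL_nth h hi, e] at h1
  exact ω.2.arcFace_ne_of_lt_firstHitG hi (by have := ω.fh_lt h; omega) h1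

/-- The last arc of the prefix leaves the neighbour of the lateral cell through the side opposite to the first side.
[cite: Glazman2015WeightedSAW, Lemma 3.1 (proof, pp. 6–7)] -/
theorem preL_sOut_last (hh : holeFaceW w ∉ D) (h : ω.IsB2a) :
    (ω.preL h).sOut (ω.2.firstHitG - 1) = ω.2.firstSideG.opp ∧
      ((ω.preL h).fc (ω.2.firstHitG - 1)).side ((ω.preL h).sOut (ω.2.firstHitG - 1)) = (latN w).side ω.2.firstSideG := by
  have hlen := preL_length (ω := ω) h
  have hfh := fhL_pos ω
  obtain ⟨-, ht, -⟩ := YBWalk.side_sIn (γ := ω.preL h) (i := ω.2.firstHitG - 1) (by rw [hlen]; omega)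
  have e1 : ω.2.firstHitG - 1 + 1 = ω.2.firstHitG := by omega
  rw [← (ω.preL h).nth_eq_getElem (by rw [(ω.preL h).length_eq, hlen]; omega)] at ht
  simp only [e1] at ht
  rw [preL_nth h le_rfl] at ht
  have ht' := ht.trans ω.2.nth_firstHitG
  exact ⟨side_eq_opp_of_side_eq' ht' (preL_fc hh h (by omega)).2.1, ht'⟩

/-- The first vertex of the prefix polyline. [folklore] -/
private theorem preL_vtx_zero (h : ω.IsB2a) : (ω.preL h).vtx 0 = (holeFaceW w).base + (4, 2) := by
  rw [YBWalk.vtx_zero, midPt_root_eq_hole]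

/-- The second vertex of a walk from the hole root, in hole coordinates. [folklore] -/
private theorem vtx_one_hole (hh : holeFaceW w ∉ D) {z : MidEdge} (γ : YBWalk D (w.side .W) z) (hn : 0 < γ.arcs.length) :
    γ.vtx 1 = (holeFaceW w).base + (5, 2) := by
  have hlen := γ.length_eq
  obtain ⟨hs, -, -⟩ := YBWalk.side_sIn (γ := γ) (i := 0) hn
  rw [← γ.nth_eq_getElem (by omega), γ.nth_zero] at hs
  have hD := (YBWalk.arcFace_arcAt (γ := γ) hn).2
  have hcases := (Face.exists_side_eq_iff (γ.fc 0) (w.side .W)).1 ⟨_, hs⟩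
  rw [root_faces_W] at hcases
  simp only at hcases
  rcases hcases with e | e
  · rw [e] at hD; exact absurd hD hh
  · rw [e] at hs
    have hsIn := Face.side_injective w hs
    have ev := YBWalk.vtx_odd (γ := γ) (i := 0) hn
    rw [show 2 * 0 + 1 = 1 from rfl] at ev
    rw [ev, YBWalk.ptIn, e, hsIn, innerPt_eq, midPt_root_eq_hole, add_assoc]
    rfl

/-- The second vertex of the prefix polyline. [folklore] -/
private theorem preL_vtx_one (hh : holeFaceW w ∉ D) (h : ω.IsB2a) : (ω.preL h).vtx 1 = (holeFaceW w).base + (5, 2) :=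
  vtx_one_hole hh (ω.preL h) (by rw [preL_length]; exact fhL_pos ω)

/-- The last-but-one vertex of the prefix polyline. [folklore] -/
private theorem preL_vtx_penult (hh : holeFaceW w ∉ D) (h : ω.IsB2a) :
    (ω.preL h).vtx (2 * ω.2.firstHitG) = (holeFaceW w).base + ((0, 4) + ω.2.firstSideG.offset - ω.2.firstSideG.nIn) := by
  have hlen := preL_length (ω := ω) h
  have hfh := fhL_pos ω
  have e := YBWalk.vtx_even (γ := ω.preL h) (i := ω.2.firstHitG - 1) (by rw [hlen]; omega)
  rw [show 2 * (ω.2.firstHitG - 1) + 2 = 2 * ω.2.firstHitG by omega] at e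
  obtain ⟨hs, ht⟩ := preL_sOut_last hh h
  rw [e, YBWalk.ptOut, innerPt_eq, ht, hs, midPt_latN_side, nIn_opp']
  abel

/-- The last vertex of the prefix polyline. [folklore] -/
private theorem preL_vtx_last (h : ω.IsB2a) :
    (ω.preL h).vtx (2 * ω.2.firstHitG + 1) = (holeFaceW w).base + ((0, 4) + ω.2.firstSideG.offset) := by
  have hlen := preL_length (ω := ω) h
  have e := YBWalk.vtx_last (γ := ω.preL h)
  rw [hlen] at e
  rw [e, ω.2.nth_firstHitG, midPt_latN_side]

/-- The inner vertices of the prefix polyline are inner points of prefix faces. [folklore] -/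
private theorem preL_vtx_inner (h : ω.IsB2a) {j : ℕ} (hj1 : 1 ≤ j) (hj2 : j ≤ 2 * ω.2.firstHitG) :
    ∃ i, i < ω.2.firstHitG ∧ ∃ s : Side, (ω.preL h).vtx j = innerPt ((ω.preL h).fc i) s := by
  have hlen := preL_length (ω := ω) h
  rcases YBWalk.index_cases (γ := ω.preL h) j (by rw [hlen]; omega) with h0 | ⟨i, hi, rfl⟩ | ⟨i, hi, rfl⟩ | h0
  · omega
  · exact ⟨i, by rw [hlen] at hi; exact hi, _, YBWalk.vtx_odd hi⟩
  · exact ⟨i, by rw [hlen] at hi; exact hi, _, YBWalk.vtx_even hi⟩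
  · rw [hlen] at h0; omega

/-- ★ The prefix stays away from the closing path `(2,6), (2,4), (2,2)` (hole coordinates), first side not `S`.
[folklore] -/
private theorem four_le_dsq_preL_vtx (hh : holeFaceW w ∉ D) (h : ω.IsB2a) (hS : ω.2.firstSideG ≠ .S) {j : ℕ}
    (hj : j ≤ 2 * ω.2.firstHitG + 1) {cy : ℤ} (hcy : cy = 2 ∨ cy = 4 ∨ cy = 6) :
    4 ≤ dsq ((ω.preL h).vtx j) ((holeFaceW w).base + (2, cy)) := by
  rcases Nat.eq_zero_or_pos j with rfl | hj0
  · rw [preL_vtx_zero h, dsq_add_left']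
    rcases hcy with rfl | rfl | rfl <;> simp [dsq]
  rcases Nat.lt_or_ge j (2 * ω.2.firstHitG + 1) with hlt | hge
  · obtain ⟨i, hi, s, e⟩ := preL_vtx_inner h hj0 (by omega)
    rw [e]
    obtain ⟨-, hf, hh'⟩ := preL_fc hh h hi
    have hf' : (ω.preL h).fc i ≠ ((holeFaceW w).1, (holeFaceW w).2 + 1) := by rw [← latN_eq]; exact hf
    exact four_le_dsq_innerPt_v hh' hf' s (by omega) (by omega)
  · have hj' : j = 2 * ω.2.firstHitG + 1 := by omega
    subst hj'
    rw [preL_vtx_last h, dsq_add_left']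
    revert hS
    cases ω.2.firstSideG <;> intro hS
    · rcases hcy with rfl | rfl | rfl <;> simp [dsq, Side.offset]
    · rcases hcy with rfl | rfl | rfl <;> simp [dsq, Side.offset]
    · exact absurd rfl hS
    · rcases hcy with rfl | rfl | rfl <;> simp [dsq, Side.offset]

end PrefixL

section PrefixHopfL

variable (ω : ΩG D (w.side .W) (latN w))

/-- **The closed prefix polygon at the lateral cell** (period `2·firstHitG + 5`): the prefix polyline, then the centre
of the lateral cell, the midpoint of its dead side `S`, and the centre of the hole. [cite: Hopf1935, Nr. 2 (Umlaufsatz, p. 53) and Nr. 4 eq. (22) (curves with corners, pp. 60–61)] -/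
def cycCL (h : ω.IsB2a) (j : ℕ) : ℤ × ℤ :=
  if j % (2 * ω.2.firstHitG + 5) ≤ 2 * ω.2.firstHitG + 1 then (ω.preL h).vtx (j % (2 * ω.2.firstHitG + 5))
  else if j % (2 * ω.2.firstHitG + 5) = 2 * ω.2.firstHitG + 2 then (holeFaceW w).base + (2, 6)
  else if j % (2 * ω.2.firstHitG + 5) = 2 * ω.2.firstHitG + 3 then (holeFaceW w).base + (2, 4)
  else (holeFaceW w).base + (2, 2)

variable {ω}

/-- Periodicity. [folklore] -/
private theorem cycCL_add (h : ω.IsB2a) (j : ℕ) : ω.cycCL h (j + (2 * ω.2.firstHitG + 5)) = ω.cycCL h j := by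
  unfold cycCL; rw [Nat.add_mod_right]

/-- The walk part. [folklore] -/
private theorem cycCL_of_le (h : ω.IsB2a) {j : ℕ} (hj : j ≤ 2 * ω.2.firstHitG + 1) : ω.cycCL h j = (ω.preL h).vtx j := by
  unfold cycCL; rw [Nat.mod_eq_of_lt (by omega), if_pos hj]

/-- The first closing vertex. [folklore] -/
private theorem cycCL_c₁ (h : ω.IsB2a) : ω.cycCL h (2 * ω.2.firstHitG + 2) = (holeFaceW w).base + (2, 6) := by
  unfold cycCL; rw [Nat.mod_eq_of_lt (by omega), if_neg (by omega), if_pos rfl]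

/-- The second closing vertex. [folklore] -/
private theorem cycCL_c₂ (h : ω.IsB2a) : ω.cycCL h (2 * ω.2.firstHitG + 3) = (holeFaceW w).base + (2, 4) := by
  unfold cycCL; rw [Nat.mod_eq_of_lt (by omega), if_neg (by omega), if_neg (by omega), if_pos rfl]

/-- The third closing vertex. [folklore] -/
private theorem cycCL_c₃ (h : ω.IsB2a) : ω.cycCL h (2 * ω.2.firstHitG + 4) = (holeFaceW w).base + (2, 2) := by
  unfold cycCL; rw [Nat.mod_eq_of_lt (by omega), if_neg (by omega), if_neg (by omega), if_neg (by omega)]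

/-- Back to the root midpoint. [folklore] -/
private theorem cycCL_N (h : ω.IsB2a) : ω.cycCL h (2 * ω.2.firstHitG + 5) = (holeFaceW w).base + (4, 2) := by
  rw [show 2 * ω.2.firstHitG + 5 = 0 + (2 * ω.2.firstHitG + 5) by ring, cycCL_add, cycCL_of_le h (by omega),
    preL_vtx_zero]

/-- … and to the second prefix vertex. [folklore] -/
private theorem cycCL_N1 (hh : holeFaceW w ∉ D) (h : ω.IsB2a) :
    ω.cycCL h (2 * ω.2.firstHitG + 6) = (holeFaceW w).base + (5, 2) := by
  rw [show 2 * ω.2.firstHitG + 6 = 1 + (2 * ω.2.firstHitG + 5) by ring, cycCL_add, cycCL_of_le h (by omega),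
    preL_vtx_one hh h]

/-- The closing vertices (values). [folklore] -/
private theorem cycCL_closing (h : ω.IsB2a) {i : ℕ} (hi1 : 2 * ω.2.firstHitG + 2 ≤ i) (hi2 : i < 2 * ω.2.firstHitG + 5) :
    ∃ cy : ℤ, (cy = 2 ∨ cy = 4 ∨ cy = 6) ∧ ω.cycCL h i = (holeFaceW w).base + (2, cy) ∧
      cy = 2 * (2 * ω.2.firstHitG + 5 - i) := by
  rcases (show i = 2 * ω.2.firstHitG + 2 ∨ i = 2 * ω.2.firstHitG + 3 ∨ i = 2 * ω.2.firstHitG + 4 by omega) with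
    rfl | rfl | rfl
  · exact ⟨6, Or.inr (Or.inr rfl), cycCL_c₁ h, by omega⟩
  · exact ⟨4, Or.inr (Or.inl rfl), cycCL_c₂ h, by omega⟩
  · exact ⟨2, Or.inl rfl, cycCL_c₃ h, by omega⟩

/-- Every vertex off a closing vertex is at squared distance `≥ 4` from it. [folklore] -/
private theorem four_le_dsq_cycCL_closing (hh : holeFaceW w ∉ D) (h : ω.IsB2a) (hS : ω.2.firstSideG ≠ .S) {i j : ℕ}
    (hi1 : 2 * ω.2.firstHitG + 2 ≤ i) (hi2 : i < 2 * ω.2.firstHitG + 5) (hj : j < 2 * ω.2.firstHitG + 5) (hij : i ≠ j) :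
    4 ≤ dsq (ω.cycCL h j) (ω.cycCL h i) := by
  obtain ⟨cy, hcy, ei, ecy⟩ := cycCL_closing h hi1 hi2
  rw [ei]
  rcases Nat.lt_or_ge j (2 * ω.2.firstHitG + 2) with hjw | hjc
  · rw [cycCL_of_le h (by omega)]
    exact four_le_dsq_preL_vtx hh h hS (by omega) hcy
  · obtain ⟨cy', hcy', ej, ecy'⟩ := cycCL_closing h hjc hj
    rw [ej, dsq_add_left']
    have hne : cy ≠ cy' := by omega
    simp only [dsq]
    rcases hcy with rfl | rfl | rfl <;> rcases hcy' with rfl | rfl | rfl <;> first | exact absurd rfl hne | norm_num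

/-- Consecutive vertices are at squared distance `≤ 4`. [folklore] -/
private theorem dsq_cycCL_succ_le (h : ω.IsB2a) {k : ℕ} (hk : k < 2 * ω.2.firstHitG + 5) :
    dsq (ω.cycCL h k) (ω.cycCL h (k + 1)) ≤ 4 := by
  have hlen := preL_length (ω := ω) h
  rcases Nat.lt_or_ge k (2 * ω.2.firstHitG + 1) with hkw | hkc
  · rw [cycCL_of_le h hkw.le, cycCL_of_le h (by omega)]
    exact dsq_vtx_succ_le' (ω.preL h) (by rw [hlen]; omega)
  · rcases (show k = 2 * ω.2.firstHitG + 1 ∨ k = 2 * ω.2.firstHitG + 2 ∨ k = 2 * ω.2.firstHitG + 3 ∨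
        k = 2 * ω.2.firstHitG + 4 by omega) with rfl | rfl | rfl | rfl
    · rw [cycCL_of_le h le_rfl, preL_vtx_last h, cycCL_c₁ h, dsq_add_left']
      cases ω.2.firstSideG <;> simp [dsq, Side.offset]
    · rw [cycCL_c₁ h, show 2 * ω.2.firstHitG + 2 + 1 = 2 * ω.2.firstHitG + 3 by ring, cycCL_c₂ h, dsq_add_left']
      simp [dsq]
    · rw [cycCL_c₂ h, show 2 * ω.2.firstHitG + 3 + 1 = 2 * ω.2.firstHitG + 4 by ring, cycCL_c₃ h, dsq_add_left']
      simp [dsq]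
    · rw [cycCL_c₃ h, show 2 * ω.2.firstHitG + 4 + 1 = 2 * ω.2.firstHitG + 5 by ring, cycCL_N h, dsq_add_left']
      simp [dsq]

/-- Injective on a period. [folklore] -/
private theorem cycCL_injective (hh : holeFaceW w ∉ D) (h : ω.IsB2a) (hS : ω.2.firstSideG ≠ .S) {i j : ℕ}
    (hi : i < 2 * ω.2.firstHitG + 5) (hj : j < 2 * ω.2.firstHitG + 5) (e : ω.cycCL h i = ω.cycCL h j) : i = j := by
  have hlen := preL_length (ω := ω) h
  have hfh := fhL_pos ω
  by_contra hij
  rcases Nat.lt_or_ge i (2 * ω.2.firstHitG + 2) with hiw | hic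
  · rcases Nat.lt_or_ge j (2 * ω.2.firstHitG + 2) with hjw | hjc
    · rw [cycCL_of_le h (by omega), cycCL_of_le h (by omega)] at e
      exact hij (YBWalk.vtx_injective (γ := ω.preL h) (by rw [hlen]; omega) (by rw [hlen]; omega) (by rw [hlen]; exact hfh) e)
    · have h4 := four_le_dsq_cycCL_closing hh h hS hjc hj hi (Ne.symm hij)
      rw [e] at h4; simp [dsq] at h4
  · have h4 := four_le_dsq_cycCL_closing hh h hS hic hi hj hij
    rw [e] at h4; simp [dsq] at h4

/-- ★ Hopf's hypothesis for the lateral prefix polygon. [cite: Hopf1935, Nr. 2 (Umlaufsatz, p. 53) and Nr. 4 eq. (22) (curves with corners, pp. 60–61)] -/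
theorem cycCL_subtended (hh : holeFaceW w ∉ D) (h : ω.IsB2a) (hS : ω.2.firstSideG ≠ .S) {k j : ℕ}
    (hk : k < 2 * ω.2.firstHitG + 5) (hj : j < 2 * ω.2.firstHitG + 5) (h1 : ω.cycCL h j ≠ ω.cycCL h k)
    (h2 : ω.cycCL h j ≠ ω.cycCL h (k + 1)) : 0 < sdot (ω.cycCL h k) (ω.cycCL h (k + 1)) (ω.cycCL h j) := by
  have hlen := preL_length (ω := ω) h
  have hfh := fhL_pos ω
  by_cases hall : k + 1 ≤ 2 * ω.2.firstHitG + 1 ∧ j ≤ 2 * ω.2.firstHitG + 1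
  · have ek : ω.cycCL h k = (ω.preL h).vtx k := cycCL_of_le h (by omega)
    have ek1 : ω.cycCL h (k + 1) = (ω.preL h).vtx (k + 1) := cycCL_of_le h hall.1
    have ej : ω.cycCL h j = (ω.preL h).vtx j := cycCL_of_le h hall.2
    rw [ej, ek] at h1
    rw [ej, ek1] at h2
    rw [ek, ek1, ej]
    refine YBWalk.subtended (γ := ω.preL h) (by rw [hlen]; omega) (by rw [hlen]; omega) ?_ ?_ (by rw [hlen]; exact hfh)
    · intro e; exact h1 (by rw [e])
    · intro e; exact h2 (by rw [e])
  · apply sdot_pos_of_dsq'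
    have hAB := dsq_cycCL_succ_le h hk
    rcases Nat.lt_or_ge j (2 * ω.2.firstHitG + 2) with hjw | hjc
    · have hk1 : 2 * ω.2.firstHitG + 1 ≤ k := by omega
      rcases Nat.lt_or_ge k (2 * ω.2.firstHitG + 2) with hkw | hkc
      · have hkm : k = 2 * ω.2.firstHitG + 1 := by omega
        subst hkm
        have hB := four_le_dsq_cycCL_closing hh h hS (i := 2 * ω.2.firstHitG + 1 + 1) (by omega) (by omega) hj
          (fun e => h2 (by rw [e]))
        have hA := one_le_dsq_of_ne' (Ne.symm h1)
        rw [dsq_comm'] at hB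
        linarith
      · rcases Nat.lt_or_ge k (2 * ω.2.firstHitG + 4) with hk4 | hk4
        · have hA := four_le_dsq_cycCL_closing hh h hS hkc hk hj (fun e => h1 (by rw [e]))
          have hB := four_le_dsq_cycCL_closing hh h hS (i := k + 1) (by omega) (by omega) hj (fun e => h2 (by rw [e]))
          rw [dsq_comm'] at hA hB
          linarith
        · have hkm : k = 2 * ω.2.firstHitG + 4 := by omega
          subst hkm
          have hA := four_le_dsq_cycCL_closing hh h hS (i := 2 * ω.2.firstHitG + 4) (by omega) (by omega) hj
            (fun e => h1 (by rw [e]))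
          have hB := one_le_dsq_of_ne' (Ne.symm h2)
          rw [dsq_comm'] at hA
          linarith
    · have hA := four_le_dsq_cycCL_closing hh h hS hjc hj hk (fun e => h1 (by rw [e]))
      have hB' : 4 ≤ dsq (ω.cycCL h (k + 1)) (ω.cycCL h j) := by
        rcases Nat.lt_or_ge (k + 1) (2 * ω.2.firstHitG + 5) with hk5 | hk5
        · exact four_le_dsq_cycCL_closing hh h hS hjc hj hk5 (fun e => h2 (by rw [e]))
        · have hk' : k + 1 = 0 + (2 * ω.2.firstHitG + 5) := by omega
          rw [hk', cycCL_add]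
          exact four_le_dsq_cycCL_closing hh h hS hjc hj (by omega) (fun e => h2 (by rw [hk', cycCL_add, e]))
      linarith

/-- ★ The exterior angles of the lateral prefix polygon add up to `WP(π/2) + π` (first side `E`) or `WP(π/2)`
(first side `W`). [cite: Hopf1935, Nr. 2 (Umlaufsatz, p. 53) and Nr. 4 eq. (22) (curves with corners, pp. 60–61)] -/
theorem sum_extAng_cycCL (hh : holeFaceW w ∉ D) (h : ω.IsB2a) (hz : ω.2.firstSideG = .E ∨ ω.2.firstSideG = .W) :
    ∑ v ∈ Finset.range (2 * ω.2.firstHitG + 5), extAng (ω.cycCL h) v =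
      ω.WP (fun _ => π / 2) + (if ω.2.firstSideG = .E then π else 0) := by
  have hlen := preL_length (ω := ω) h
  have hπ := Real.pi_pos
  have hwalk : ∑ v ∈ Finset.range (2 * ω.2.firstHitG), extAng (ω.cycCL h) v = ω.WP (fun _ => π / 2) := by
    rw [← preL_winding h, ← YBWalk.sum_ext_angles_eq_winding (γ := ω.preL h), hlen]
    refine Finset.sum_congr rfl fun v hv => ?_
    rw [Finset.mem_range] at hv
    simp only [extAng, YBWalk.cvtx, cycCL_of_le h (show v ≤ 2 * ω.2.firstHitG + 1 by omega),
      cycCL_of_le h (show v + 1 ≤ 2 * ω.2.firstHitG + 1 by omega), cycCL_of_le h (show v + 2 ≤ 2 * ω.2.firstHitG + 1 by omega)]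
  rw [show 2 * ω.2.firstHitG + 5 = 2 * ω.2.firstHitG + 1 + 1 + 1 + 1 + 1 by ring, Finset.sum_range_succ,
    Finset.sum_range_succ, Finset.sum_range_succ, Finset.sum_range_succ, Finset.sum_range_succ, hwalk]
  have e0 : ω.cycCL h (2 * ω.2.firstHitG) = (holeFaceW w).base + ((0, 4) + ω.2.firstSideG.offset - ω.2.firstSideG.nIn) := by
    rw [cycCL_of_le h (by omega), preL_vtx_penult hh h]
  have e1 : ω.cycCL h (2 * ω.2.firstHitG + 1) = (holeFaceW w).base + ((0, 4) + ω.2.firstSideG.offset) := by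
    rw [cycCL_of_le h le_rfl, preL_vtx_last h]
  have e2 := cycCL_c₁ (ω := ω) h
  have e3 := cycCL_c₂ (ω := ω) h
  have e4 := cycCL_c₃ (ω := ω) h
  have e5 := cycCL_N (ω := ω) h
  have e6 := cycCL_N1 (ω := ω) hh h
  simp only [extAng]
  rw [show 2 * ω.2.firstHitG + 1 + 1 = 2 * ω.2.firstHitG + 2 by ring, show 2 * ω.2.firstHitG + 2 + 1 = 2 * ω.2.firstHitG + 3 by ring,
    show 2 * ω.2.firstHitG + 3 + 1 = 2 * ω.2.firstHitG + 4 by ring, show 2 * ω.2.firstHitG + 4 + 1 = 2 * ω.2.firstHitG + 5 by ring,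
    show 2 * ω.2.firstHitG + 2 + 2 = 2 * ω.2.firstHitG + 4 by ring, show 2 * ω.2.firstHitG + 3 + 2 = 2 * ω.2.firstHitG + 5 by ring,
    show 2 * ω.2.firstHitG + 4 + 2 = 2 * ω.2.firstHitG + 6 by ring, show 2 * ω.2.firstHitG + 1 + 2 = 2 * ω.2.firstHitG + 3 by ring,
    e0, e1, e2, e3, e4, e5, e6]
  simp only [toC_add_sub_add']
  have a20 : Complex.arg (toC (((2 : ℤ), (0 : ℤ)))) = 0 := arg_toC_pos_zero' (by norm_num)
  have a10 : Complex.arg (toC (((1 : ℤ), (0 : ℤ)))) = 0 := arg_toC_pos_zero' (by norm_num)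
  have v1 : ((2 : ℤ), (4 : ℤ)) - ((2 : ℤ), (6 : ℤ)) = (0, -(2 : ℤ)) := by simp
  have v2 : ((2 : ℤ), (2 : ℤ)) - ((2 : ℤ), (4 : ℤ)) = (0, -(2 : ℤ)) := by simp
  have v3 : ((4 : ℤ), (2 : ℤ)) - ((2 : ℤ), (2 : ℤ)) = (2, 0) := by simp
  have v4 : ((5 : ℤ), (2 : ℤ)) - ((4 : ℤ), (2 : ℤ)) = (1, 0) := by simp
  rw [v1, v2, v3, v4, arg_toC_zero_neg' two_pos, a20, a10]
  rcases hz with hz | hz <;> rw [hz] <;> simp only [Side.offset, Side.nIn, reduceCtorEq, if_true, if_false]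
  · -- first side E: last = (4,6), in-vector (−1,0), corner vectors (−2,0) then (0,−2)
    have u1 : ((0 : ℤ), (4 : ℤ)) + ((4 : ℤ), (2 : ℤ)) - (((0 : ℤ), (4 : ℤ)) + ((4 : ℤ), (2 : ℤ)) - ((-1 : ℤ), (0 : ℤ))) = (-(1 : ℤ), 0) := by simp
    have u2 : ((2 : ℤ), (6 : ℤ)) - (((0 : ℤ), (4 : ℤ)) + ((4 : ℤ), (2 : ℤ))) = (-(2 : ℤ), 0) := by simp
    rw [u1, u2, arg_toC_neg_zero' one_pos, arg_toC_neg_zero' two_pos]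
    have t2 : (((-(π / 2) : ℝ) : Real.Angle) - (((π : ℝ)) : Real.Angle)).toReal = π / 2 :=
      toReal_sub_coe_add' (by ring) ⟨by linarith, by linarith⟩
    have t4 : (((0 : ℝ) : Real.Angle) - (((-(π / 2)) : ℝ) : Real.Angle)).toReal = π / 2 :=
      toReal_sub_coe' (by ring) ⟨by linarith, by linarith⟩
    rw [t2, t4]
    simp only [sub_self, Real.Angle.toReal_zero]
    ring
  · -- first side W: last = (0,6), in-vector (1,0), corner vectors (2,0) then (0,−2)
    have u1 : ((0 : ℤ), (4 : ℤ)) + ((0 : ℤ), (2 : ℤ)) - (((0 : ℤ), (4 : ℤ)) + ((0 : ℤ), (2 : ℤ)) - ((1 : ℤ), (0 : ℤ))) = (1, 0) := by simp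
    have u2 : ((2 : ℤ), (6 : ℤ)) - (((0 : ℤ), (4 : ℤ)) + ((0 : ℤ), (2 : ℤ))) = (2, 0) := by simp
    rw [u1, u2, a10, a20]
    have t2 : (((-(π / 2) : ℝ) : Real.Angle) - (((0 : ℝ)) : Real.Angle)).toReal = -(π / 2) :=
      toReal_sub_coe' (by ring) ⟨by linarith, by linarith⟩
    have t4 : (((0 : ℝ) : Real.Angle) - (((-(π / 2)) : ℝ) : Real.Angle)).toReal = π / 2 :=
      toReal_sub_coe' (by ring) ⟨by linarith, by linarith⟩
    rw [t2, t4]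
    simp only [sub_self, Real.Angle.toReal_zero]
    ring

/-- ★★ **THE PREFIX AT THE LATERAL CELL TURNS BY ONE OF TWO VALUES**: first side `E` ⇒ `WP(π/2) ∈ {π, −3π}`; first
side `W` ⇒ `WP(π/2) ∈ {2π, −2π}`. [cite: Hopf1935, Nr. 2 (Umlaufsatz, p. 53) and Nr. 4 eq. (22) (curves with corners, pp. 60–61)] [cite: GlazmanManolescu2019, Lemma 2.1 (proof: [Gl])] -/
theorem WP_pi_div_two_mem_latN (hh : holeFaceW w ∉ D) (h : ω.IsB2a) (hz : ω.2.firstSideG = .E ∨ ω.2.firstSideG = .W) :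
    (ω.2.firstSideG = .E → ω.WP (fun _ => π / 2) = π ∨ ω.WP (fun _ => π / 2) = -(3 * π)) ∧
      (ω.2.firstSideG = .W → ω.WP (fun _ => π / 2) = 2 * π ∨ ω.WP (fun _ => π / 2) = -(2 * π)) := by
  have hS : ω.2.firstSideG ≠ .S := by rcases hz with hz | hz <;> rw [hz] <;> decide
  have key := hopf_cyclic_int (ω.cycCL h) (N := 2 * ω.2.firstHitG + 5) (by omega) (cycCL_add h)
    (fun i j hi hj e => cycCL_injective hh h hS hi hj e) (fun k j hk hj h1 h2 => cycCL_subtended hh h hS hk hj h1 h2)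
  rw [sum_extAng_cycCL hh h hz] at key
  constructor
  · intro hE; rw [hE] at key; simp only [if_true] at key
    rcases key with e | e
    · left; linarith
    · right; linarith
  · intro hW; rw [hW] at key; simp only [reduceCtorEq, if_false] at key
    rcases key with e | e
    · left; linarith
    · right; linarith

end PrefixHopfL

end ΩG

end Literature.Probability.RandomPlanarGeometry.SAW.YangBaxter

namespace Literature.Probability.RandomPlanarGeometry.SAW.YangBaxter

open Real Complex

namespace ΩG

variable {D : Set Face} {w : Face}

section WholeWalkL

variable {ω : ΩG D (w.side .W) (latN w)} {hr : RootedFace D (w.side .W) (latN w)}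

/-- In class `B2a` the walk has at least `firstHitG + 3` arcs. [cite: Glazman2015WeightedSAW, Lemma 3.1 (proof, pp. 6–7)] -/
theorem fh_add_three_le_L (hr : RootedFace D (w.side .W) (latN w)) (h : ω.IsB2a) :
    ω.2.firstHitG + 3 ≤ ω.2.arcs.length := by
  have := ω.2.firstHit_add_three_le_returnHitG hr h.1; rw [h.2] at this; exact this

/-- The arc inside the lateral cell: face, entry side, exit side. [cite: Glazman2015WeightedSAW, Lemma 3.1 (proof, pp. 6–7)] -/
theorem fc_firstHit_lat (hr : RootedFace D (w.side .W) (latN w)) (h : ω.IsB2a) :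
    ω.2.fc ω.2.firstHitG = latN w ∧ ω.2.sIn ω.2.firstHitG = ω.2.firstSideG ∧ ω.2.sOut ω.2.firstHitG = ω.z1 hr h := by
  have hfh := ω.fh_lt h
  obtain ⟨hz01, -, -⟩ := ω.firstSide_exit_return_distinct hr h
  have hlen := ω.2.length_eq
  obtain ⟨hs, ht, -⟩ := YBWalk.side_sIn (γ := ω.2) hfh
  rw [← ω.2.nth_eq_getElem (by omega), ω.2.nth_firstHitG] at hs
  rw [← ω.2.nth_eq_getElem (by omega), (ω.2.exitSide_specG hr hfh).1] at ht
  have hface : ω.2.fc ω.2.firstHitG = latN w := by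
    have h1 := ω.2.arcFace_nth_eq_some_fcFRL hfh
    rw [ω.2.nth_firstHitG, (ω.2.exitSide_specG hr hfh).1,
      arcFace_side_side (latN w) ω.2.firstSideG (ω.2.exitSideG hr hfh) hz01] at h1
    exact (Option.some_injective _ h1).symm
  refine ⟨hface, ?_, ?_⟩
  · rw [hface] at hs; exact Face.side_injective _ hs
  · rw [hface] at ht; exact Face.side_injective _ ht

/-- The total turning splits at the lateral cell. [cite: GlazmanManolescu2019, Lemma 2.1 (proof: [Gl])] -/
theorem winding_eq_WP_add_L (hr : RootedFace D (w.side .W) (latN w)) (h : ω.IsB2a) (Θ : ℤ → ℝ) :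
    ω.2.winding Θ = ω.WP Θ + arcTurn (Θ (latN w).1) ω.2.firstSideG (ω.z1 hr h) + ω.WE Θ := by
  have hfh := ω.fh_lt h
  obtain ⟨hfc, hsIn, hsOut⟩ := fc_firstHit_lat hr h
  have hsplit : ω.2.arcs = ω.2.arcs.take ω.2.firstHitG ++ (ω.2.arcAt ω.2.firstHitG :: ω.2.arcs.drop (ω.2.firstHitG + 1)) := by
    rw [YBWalk.arcAt, List.getD_eq_getElem' hfh, ← List.drop_eq_getElem_cons hfh, List.take_append_drop]
  have e1 : (ω.2.fc ω.2.firstHitG).1 = (latN w).1 := by rw [hfc]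
  have e2 : sideIn (ω.2.arcAt ω.2.firstHitG) = ω.2.firstSideG := hsIn
  have e3 : sideOut (ω.2.arcAt ω.2.firstHitG) = ω.z1 hr h := hsOut
  unfold YBWalk.winding ΩG.WP ΩG.WE
  conv_lhs => rw [hsplit]
  rw [List.map_append, List.map_cons, List.sum_append, List.sum_cons,
    arcTurnOf_eq_arcTurn (YBWalk.arcFace_arcAt (γ := ω.2) hfh).1, e1, e2, e3]
  ring

/-- Interior vertices of the walk polyline are inner points. [folklore] -/
private theorem vtx_inner_L (γ : YBWalk D (w.side .W) ((latN w).side ω.1)) {j : ℕ} (hj1 : 1 ≤ j) (hj2 : j ≤ 2 * γ.arcs.length) :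
    ∃ i, i < γ.arcs.length ∧ (γ.vtx j = innerPt (γ.fc i) (γ.sIn i) ∨ γ.vtx j = innerPt (γ.fc i) (γ.sOut i)) := by
  rcases YBWalk.index_cases (γ := γ) j (by omega) with h0 | ⟨i, hi, rfl⟩ | ⟨i, hi, rfl⟩ | h0
  · omega
  · exact ⟨i, hi, Or.inl (YBWalk.vtx_odd hi)⟩
  · exact ⟨i, hi, Or.inr (YBWalk.vtx_even hi)⟩
  · omega

/-- The faces of the arcs other than the one inside the lateral cell are neither the lateral cell nor the hole.
[cite: Glazman2015WeightedSAW, Lemma 3.1 (proof, pp. 6–7)] -/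
theorem fc_ne_lat (hh : holeFaceW w ∉ D) (hr : RootedFace D (w.side .W) (latN w)) (h : ω.IsB2a) {i : ℕ}
    (hi : i < ω.2.arcs.length) (hne : i ≠ ω.2.firstHitG) :
    ω.2.fc i ∈ D ∧ ω.2.fc i ≠ latN w ∧ ω.2.fc i ≠ holeFaceW w := by
  have hD := (YBWalk.arcFace_arcAt (γ := ω.2) hi).2
  refine ⟨hD, fun e => ?_, fun e => hh (e ▸ hD)⟩
  have h1 := ω.2.arcFace_nth_eq_some_fcFRL hi
  rw [e] at h1
  rcases Nat.lt_or_gt_of_ne hne with hlt | hgt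
  · exact ω.2.arcFace_ne_of_lt_firstHitG hlt hi h1
  · exact ω.2.arcFace_ne_of_excursionG hr h.1 hgt (by rw [h.2]; exact hi) h1

variable (ω)

/-- **The closed whole-walk polygon at the lateral cell** (period `2·n + 5`): the walk polyline, then the corner-type
point `hole.base + (2,5) + z₀.nIn`, the midpoint of the dead side `S` and the centre of the hole.
[cite: Hopf1935, Nr. 2 (Umlaufsatz, p. 53) and Nr. 4 eq. (22) (curves with corners, pp. 60–61)] -/
def cycPL (_h : ω.IsB2a) (j : ℕ) : ℤ × ℤ :=
  if j % (2 * ω.2.arcs.length + 5) ≤ 2 * ω.2.arcs.length + 1 then ω.2.vtx (j % (2 * ω.2.arcs.length + 5))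
  else if j % (2 * ω.2.arcs.length + 5) = 2 * ω.2.arcs.length + 2 then (holeFaceW w).base + ((2, 5) + ω.2.firstSideG.nIn)
  else if j % (2 * ω.2.arcs.length + 5) = 2 * ω.2.arcs.length + 3 then (holeFaceW w).base + (2, 4)
  else (holeFaceW w).base + (2, 2)

variable {ω}

/-- Periodicity. [folklore] -/
private theorem cycPL_add (h : ω.IsB2a) (j : ℕ) : ω.cycPL h (j + (2 * ω.2.arcs.length + 5)) = ω.cycPL h j := by
  unfold cycPL; rw [Nat.add_mod_right]

/-- Walk part. [folklore] -/
private theorem cycPL_of_le (h : ω.IsB2a) {j : ℕ} (hj : j ≤ 2 * ω.2.arcs.length + 1) : ω.cycPL h j = ω.2.vtx j := by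
  unfold cycPL; rw [Nat.mod_eq_of_lt (by omega), if_pos hj]

/-- First closing vertex. [folklore] -/
private theorem cycPL_q (h : ω.IsB2a) : ω.cycPL h (2 * ω.2.arcs.length + 2) = (holeFaceW w).base + ((2, 5) + ω.2.firstSideG.nIn) := by
  unfold cycPL; rw [Nat.mod_eq_of_lt (by omega), if_neg (by omega), if_pos rfl]

/-- Second closing vertex. [folklore] -/
private theorem cycPL_c₂ (h : ω.IsB2a) : ω.cycPL h (2 * ω.2.arcs.length + 3) = (holeFaceW w).base + (2, 4) := by
  unfold cycPL; rw [Nat.mod_eq_of_lt (by omega), if_neg (by omega), if_neg (by omega), if_pos rfl]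

/-- Third closing vertex. [folklore] -/
private theorem cycPL_c₃ (h : ω.IsB2a) : ω.cycPL h (2 * ω.2.arcs.length + 4) = (holeFaceW w).base + (2, 2) := by
  unfold cycPL; rw [Nat.mod_eq_of_lt (by omega), if_neg (by omega), if_neg (by omega), if_neg (by omega)]

/-- Back to the root midpoint. [folklore] -/
private theorem cycPL_N (h : ω.IsB2a) : ω.cycPL h (2 * ω.2.arcs.length + 5) = (holeFaceW w).base + (4, 2) := by
  rw [show 2 * ω.2.arcs.length + 5 = 0 + (2 * ω.2.arcs.length + 5) by ring, cycPL_add, cycPL_of_le h (by omega),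
    YBWalk.vtx_zero, midPt_root_eq_hole]

/-- … and to the second walk vertex. [folklore] -/
private theorem cycPL_N1 (hh : holeFaceW w ∉ D) (h : ω.IsB2a) : ω.cycPL h (2 * ω.2.arcs.length + 6) = (holeFaceW w).base + (5, 2) := by
  rw [show 2 * ω.2.arcs.length + 6 = 1 + (2 * ω.2.arcs.length + 5) by ring, cycPL_add, cycPL_of_le h (by omega),
    vtx_one_hole hh ω.2 (by have := ω.fh_lt h; omega)]

/-- Last walk vertex. [folklore] -/
private theorem cycPL_last (h : ω.IsB2a) : ω.cycPL h (2 * ω.2.arcs.length + 1) = (holeFaceW w).base + ((0, 4) + (ω.1).offset) := by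
  rw [cycPL_of_le h le_rfl, YBWalk.vtx_last, midPt_latN_side]

/-- Last-but-one walk vertex (return side opposite to the first side). [folklore] -/
private theorem cycPL_penult (hh : holeFaceW w ∉ D) (hr : RootedFace D (w.side .W) (latN w)) (h : ω.IsB2a)
    (h2 : ω.1 = ω.2.firstSideG.opp) :
    ω.cycPL h (2 * ω.2.arcs.length) = (holeFaceW w).base + ((0, 4) + (ω.1).offset + ω.2.firstSideG.nIn) := by
  have h3 := fh_add_three_le_L hr h
  have hlen := ω.2.length_eq
  rw [cycPL_of_le h (by omega)]
  have e := YBWalk.vtx_even (γ := ω.2) (i := ω.2.arcs.length - 1) (by omega)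
  rw [show 2 * (ω.2.arcs.length - 1) + 2 = 2 * ω.2.arcs.length by omega] at e
  obtain ⟨-, ht, -⟩ := YBWalk.side_sIn (γ := ω.2) (i := ω.2.arcs.length - 1) (by omega)
  rw [← ω.2.nth_eq_getElem (by omega)] at ht
  simp only [show ω.2.arcs.length - 1 + 1 = ω.2.arcs.length by omega] at ht
  rw [ω.2.nth_length] at ht
  have hs := side_eq_opp_of_side_eq' ht (fc_ne_lat hh hr h (by omega) (by omega)).2.1
  have hopp : ∀ s : Side, ω.1 = s.opp → (ω.1).opp = s := fun s hs' => by rw [hs', side_opp_opp']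
  rw [e, YBWalk.ptOut, innerPt_eq, ht, hs, midPt_latN_side, hopp _ h2, add_assoc]

/-- Walk vertices against the closing points `(2,4)` and `(2,2)`: squared distance `≥ 4`. [folklore] -/
private theorem four_le_dsq_vtx_cL (hh : holeFaceW w ∉ D) (hr : RootedFace D (w.side .W) (latN w)) (h : ω.IsB2a)
    (hz : ω.2.firstSideG = .E ∨ ω.2.firstSideG = .W) (h1 : ω.z1 hr h = .N) (h2 : ω.1 = ω.2.firstSideG.opp)
    {j : ℕ} (hj : j ≤ 2 * ω.2.arcs.length + 1) {cy : ℤ} (hcy : cy = 4 ∨ cy = 2) :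
    4 ≤ dsq (ω.2.vtx j) ((holeFaceW w).base + (2, cy)) := by
  rcases Nat.eq_zero_or_pos j with rfl | hj0
  · rw [YBWalk.vtx_zero, midPt_root_eq_hole, dsq_add_left']
    rcases hcy with rfl | rfl <;> simp [dsq]
  rcases Nat.lt_or_ge j (2 * ω.2.arcs.length + 1) with hlt | hge
  · obtain ⟨i, hi, e⟩ := vtx_inner_L ω.2 hj0 (by omega)
    by_cases hif : i = ω.2.firstHitG
    · subst hif
      obtain ⟨hfc, hsIn, hsOut⟩ := fc_firstHit_lat hr h
      rw [hfc, hsIn, hsOut, h1] at e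
      rcases e with e | e <;> rw [e, innerPt, latN_base, add_assoc, dsq_add_left']
      · rcases hz with hz | hz <;> rw [hz] <;> rcases hcy with rfl | rfl <;> simp [dsq, Side.inOff, Side.offset, Side.nIn]
      · rcases hcy with rfl | rfl <;> simp [dsq, Side.inOff, Side.offset, Side.nIn]
    · obtain ⟨-, hf, hh'⟩ := fc_ne_lat hh hr h hi hif
      have hf' : ω.2.fc i ≠ ((holeFaceW w).1, (holeFaceW w).2 + 1) := by rw [← latN_eq]; exact hf
      rcases e with e | e <;> rw [e] <;> exact four_le_dsq_innerPt_v hh' hf' _ (by omega) (by omega)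
  · have hj' : j = 2 * ω.2.arcs.length + 1 := by omega
    subst hj'
    have hoff : ∀ s : Side, ω.1 = s.opp → (ω.1).offset = s.opp.offset := fun s hs' => by rw [hs']
    rw [YBWalk.vtx_last, midPt_latN_side, dsq_add_left', hoff _ h2]
    rcases hz with hz | hz <;> rw [hz] <;> rcases hcy with rfl | rfl <;> simp [dsq, Side.opp, Side.offset]

/-- Walk vertices other than the last against the first closing point: squared distance `≥ 4`. [folklore] -/
private theorem four_le_dsq_vtx_qL (hh : holeFaceW w ∉ D) (hr : RootedFace D (w.side .W) (latN w)) (h : ω.IsB2a)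
    (hz : ω.2.firstSideG = .E ∨ ω.2.firstSideG = .W) (h1 : ω.z1 hr h = .N)
    {j : ℕ} (hj : j ≤ 2 * ω.2.arcs.length) :
    4 ≤ dsq (ω.2.vtx j) ((holeFaceW w).base + ((2, 5) + ω.2.firstSideG.nIn)) := by
  rcases Nat.eq_zero_or_pos j with rfl | hj0
  · rw [YBWalk.vtx_zero, midPt_root_eq_hole, dsq_add_left']
    rcases hz with hz | hz <;> rw [hz] <;> simp [dsq, Side.nIn]
  · obtain ⟨i, hi, e⟩ := vtx_inner_L ω.2 hj0 hj
    by_cases hif : i = ω.2.firstHitG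
    · subst hif
      obtain ⟨hfc, hsIn, hsOut⟩ := fc_firstHit_lat hr h
      rw [hfc, hsIn, hsOut, h1] at e
      rcases e with e | e <;> rw [e, innerPt, latN_base, add_assoc, dsq_add_left']
      · rcases hz with hz | hz <;> rw [hz] <;> simp [dsq, Side.inOff, Side.offset, Side.nIn]
      · rcases hz with hz | hz <;> rw [hz] <;> simp [dsq, Side.inOff, Side.offset, Side.nIn]
    · obtain ⟨-, hf, hh'⟩ := fc_ne_lat hh hr h hi hif
      have hf' : ω.2.fc i ≠ ((holeFaceW w).1, (holeFaceW w).2 + 1) := by rw [← latN_eq]; exact hf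
      rcases hz with hz | hz <;> rw [hz] <;> rcases e with e | e <;> rw [e] <;>
        exact four_le_dsq_innerPt_v hh' hf' _ (by simp [Side.nIn]) (by simp [Side.nIn])

/-- The last walk vertex against the first closing point: squared distance `2`. [folklore] -/
private theorem dsq_last_qL (h : ω.IsB2a) (hz : ω.2.firstSideG = .E ∨ ω.2.firstSideG = .W) (h2 : ω.1 = ω.2.firstSideG.opp) :
    dsq (ω.cycPL h (2 * ω.2.arcs.length + 1)) (ω.cycPL h (2 * ω.2.arcs.length + 2)) = 2 := by
  have hoff : ∀ s : Side, ω.1 = s.opp → (ω.1).offset = s.opp.offset := fun s hs' => by rw [hs']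
  rw [cycPL_last h, cycPL_q h, dsq_add_left', hoff _ h2]
  rcases hz with hz | hz <;> rw [hz] <;> simp [dsq, Side.opp, Side.offset, Side.nIn]

/-- Index classification. [folklore] -/
private theorem idxPL {n i : ℕ} (hi : i < 2 * n + 5) :
    i ≤ 2 * n + 1 ∨ i = 2 * n + 2 ∨ i = 2 * n + 3 ∨ i = 2 * n + 4 := by omega

/-- ★ Master distance table. [folklore] -/
private theorem dsq_cycPL_closing (hh : holeFaceW w ∉ D) (hr : RootedFace D (w.side .W) (latN w)) (h : ω.IsB2a)
    (hz : ω.2.firstSideG = .E ∨ ω.2.firstSideG = .W) (h1 : ω.z1 hr h = .N) (h2 : ω.1 = ω.2.firstSideG.opp)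
    {i j : ℕ} (hi1 : 2 * ω.2.arcs.length + 2 ≤ i) (hi2 : i < 2 * ω.2.arcs.length + 5)
    (hj : j < 2 * ω.2.arcs.length + 5) (hij : i ≠ j) :
    2 ≤ dsq (ω.cycPL h j) (ω.cycPL h i) ∧
      (¬((j = 2 * ω.2.arcs.length + 1 ∧ i = 2 * ω.2.arcs.length + 2) ∨
          (j = 2 * ω.2.arcs.length + 3 ∧ i = 2 * ω.2.arcs.length + 2) ∨
          (j = 2 * ω.2.arcs.length + 2 ∧ i = 2 * ω.2.arcs.length + 3)) →
        4 ≤ dsq (ω.cycPL h j) (ω.cycPL h i)) := by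
  set n := ω.2.arcs.length with hn
  rcases (show i = 2 * n + 2 ∨ i = 2 * n + 3 ∨ i = 2 * n + 4 by omega) with rfl | rfl | rfl
  · rcases idxPL hj with hjw | rfl | rfl | rfl
    · rcases Nat.lt_or_ge j (2 * n + 1) with hjl | hjl
      · rw [cycPL_q h, cycPL_of_le h hjw]
        have := four_le_dsq_vtx_qL hh hr h hz h1 (j := j) (by omega)
        exact ⟨by omega, fun _ => this⟩
      · have hj' : j = 2 * n + 1 := by omega
        subst hj'
        rw [dsq_last_qL h hz h2]
        exact ⟨le_rfl, fun hno => absurd (Or.inl ⟨rfl, rfl⟩) hno⟩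
    · exact absurd rfl hij
    · rw [cycPL_c₂ h, cycPL_q h, dsq_add_left']
      refine ⟨?_, fun hno => absurd (Or.inr (Or.inl ⟨rfl, rfl⟩)) hno⟩
      rcases hz with hz | hz <;> rw [hz] <;> simp [dsq, Side.nIn]
    · rw [cycPL_c₃ h, cycPL_q h, dsq_add_left']
      rcases hz with hz | hz <;> rw [hz] <;> simp [dsq, Side.nIn]
  · rcases idxPL hj with hjw | rfl | rfl | rfl
    · rw [cycPL_c₂ h, cycPL_of_le h hjw]
      have := four_le_dsq_vtx_cL hh hr h hz h1 h2 hjw (cy := 4) (Or.inl rfl)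
      exact ⟨by omega, fun _ => this⟩
    · rw [cycPL_q h, cycPL_c₂ h, dsq_add_left']
      refine ⟨?_, fun hno => absurd (Or.inr (Or.inr ⟨rfl, rfl⟩)) hno⟩
      rcases hz with hz | hz <;> rw [hz] <;> simp [dsq, Side.nIn]
    · exact absurd rfl hij
    · rw [cycPL_c₃ h, cycPL_c₂ h, dsq_add_left']; simp [dsq]
  · rcases idxPL hj with hjw | rfl | rfl | rfl
    · rw [cycPL_c₃ h, cycPL_of_le h hjw]
      have := four_le_dsq_vtx_cL hh hr h hz h1 h2 hjw (cy := 2) (Or.inr rfl)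
      exact ⟨by omega, fun _ => this⟩
    · rw [cycPL_q h, cycPL_c₃ h, dsq_add_left']
      rcases hz with hz | hz <;> rw [hz] <;> simp [dsq, Side.nIn]
    · rw [cycPL_c₂ h, cycPL_c₃ h, dsq_add_left']; simp [dsq]
    · exact absurd rfl hij

/-- Consecutive vertices at squared distance `≤ 4`. [folklore] -/
private theorem dsq_cycPL_succ_le (h : ω.IsB2a) (hz : ω.2.firstSideG = .E ∨ ω.2.firstSideG = .W) (h2 : ω.1 = ω.2.firstSideG.opp)
    {k : ℕ} (hk : k < 2 * ω.2.arcs.length + 5) : dsq (ω.cycPL h k) (ω.cycPL h (k + 1)) ≤ 4 := by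
  rcases Nat.lt_or_ge k (2 * ω.2.arcs.length + 1) with hkw | hkc
  · rw [cycPL_of_le h hkw.le, cycPL_of_le h (by omega)]
    exact dsq_vtx_succ_le' ω.2 (by omega)
  · rcases (show k = 2 * ω.2.arcs.length + 1 ∨ k = 2 * ω.2.arcs.length + 2 ∨ k = 2 * ω.2.arcs.length + 3 ∨
        k = 2 * ω.2.arcs.length + 4 by omega) with rfl | rfl | rfl | rfl
    · rw [dsq_last_qL h hz h2]; norm_num
    · rw [cycPL_q h, show 2 * ω.2.arcs.length + 2 + 1 = 2 * ω.2.arcs.length + 3 by ring, cycPL_c₂ h, dsq_add_left']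
      rcases hz with hz | hz <;> rw [hz] <;> simp [dsq, Side.nIn]
    · rw [cycPL_c₂ h, show 2 * ω.2.arcs.length + 3 + 1 = 2 * ω.2.arcs.length + 4 by ring, cycPL_c₃ h, dsq_add_left']
      simp [dsq]
    · rw [cycPL_c₃ h, show 2 * ω.2.arcs.length + 4 + 1 = 2 * ω.2.arcs.length + 5 by ring, cycPL_N h, dsq_add_left']
      simp [dsq]

/-- Injective on a period. [folklore] -/
private theorem cycPL_injective (hh : holeFaceW w ∉ D) (hr : RootedFace D (w.side .W) (latN w)) (h : ω.IsB2a)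
    (hz : ω.2.firstSideG = .E ∨ ω.2.firstSideG = .W) (h1 : ω.z1 hr h = .N) (h2 : ω.1 = ω.2.firstSideG.opp)
    {i j : ℕ} (hi : i < 2 * ω.2.arcs.length + 5) (hj : j < 2 * ω.2.arcs.length + 5) (e : ω.cycPL h i = ω.cycPL h j) :
    i = j := by
  have hn : 0 < ω.2.arcs.length := by have := ω.fh_lt h; omega
  by_contra hij
  rcases Nat.lt_or_ge i (2 * ω.2.arcs.length + 2) with hiw | hic
  · rcases Nat.lt_or_ge j (2 * ω.2.arcs.length + 2) with hjw | hjc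
    · rw [cycPL_of_le h (by omega), cycPL_of_le h (by omega)] at e
      exact hij (YBWalk.vtx_injective (γ := ω.2) (by omega) (by omega) hn e)
    · have h4 := (dsq_cycPL_closing hh hr h hz h1 h2 hjc hj hi (Ne.symm hij)).1
      rw [e] at h4; simp [dsq] at h4
  · have h4 := (dsq_cycPL_closing hh hr h hz h1 h2 hic hi hj hij).1
    rw [e] at h4; simp [dsq] at h4

/-- ★ Hopf's hypothesis for the lateral whole-walk polygon. [cite: Hopf1935, Nr. 2 (Umlaufsatz, p. 53) and Nr. 4 eq. (22) (curves with corners, pp. 60–61)] -/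
theorem cycPL_subtended (hh : holeFaceW w ∉ D) (hr : RootedFace D (w.side .W) (latN w)) (h : ω.IsB2a)
    (hz : ω.2.firstSideG = .E ∨ ω.2.firstSideG = .W) (h1 : ω.z1 hr h = .N) (h2 : ω.1 = ω.2.firstSideG.opp)
    {k j : ℕ} (hk : k < 2 * ω.2.arcs.length + 5) (hj : j < 2 * ω.2.arcs.length + 5)
    (hne1 : ω.cycPL h j ≠ ω.cycPL h k) (hne2 : ω.cycPL h j ≠ ω.cycPL h (k + 1)) :
    0 < sdot (ω.cycPL h k) (ω.cycPL h (k + 1)) (ω.cycPL h j) := by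
  set n := ω.2.arcs.length with hn
  have hn0 : 0 < n := by have := ω.fh_lt h; omega
  by_cases hall : k + 1 ≤ 2 * n + 1 ∧ j ≤ 2 * n + 1
  · have ek : ω.cycPL h k = ω.2.vtx k := cycPL_of_le h (by omega)
    have ek1 : ω.cycPL h (k + 1) = ω.2.vtx (k + 1) := cycPL_of_le h hall.1
    have ej : ω.cycPL h j = ω.2.vtx j := cycPL_of_le h hall.2
    rw [ej, ek] at hne1
    rw [ej, ek1] at hne2
    rw [ek, ek1, ej]
    refine YBWalk.subtended (γ := ω.2) (by omega) (by omega) ?_ ?_ hn0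
    · intro e; exact hne1 (by rw [e])
    · intro e; exact hne2 (by rw [e])
  · apply sdot_pos_of_dsq'
    have hAB := dsq_cycPL_succ_le h hz h2 hk
    have hidx : ∀ {i : ℕ}, i < 2 * n + 5 → ω.cycPL h j ≠ ω.cycPL h i → (2 * n + 2 ≤ i ∨ 2 * n + 2 ≤ j) →
        2 ≤ dsq (ω.cycPL h i) (ω.cycPL h j) ∧
          (¬((j = 2 * n + 1 ∧ i = 2 * n + 2) ∨ (j = 2 * n + 3 ∧ i = 2 * n + 2) ∨ (j = 2 * n + 2 ∧ i = 2 * n + 3) ∨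
              (i = 2 * n + 1 ∧ j = 2 * n + 2) ∨ (i = 2 * n + 3 ∧ j = 2 * n + 2) ∨ (i = 2 * n + 2 ∧ j = 2 * n + 3)) →
            4 ≤ dsq (ω.cycPL h i) (ω.cycPL h j)) := by
      intro i hi hne hc
      have hij : i ≠ j := fun e => hne (by rw [e])
      rcases hc with hic | hjc
      · obtain ⟨a, b⟩ := dsq_cycPL_closing hh hr h hz h1 h2 hic hi hj hij
        rw [dsq_comm'] at a
        exact ⟨a, fun hno => by rw [dsq_comm']; exact b fun hh' => hno (by omega)⟩
      · obtain ⟨a, b⟩ := dsq_cycPL_closing hh hr h hz h1 h2 hjc hj hi (Ne.symm hij)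
        exact ⟨a, fun hno => b fun hh' => hno (by omega)⟩
    have hk1' : ω.cycPL h (k + 1) = ω.cycPL h ((k + 1) % (2 * n + 5)) := by
      rcases Nat.lt_or_ge (k + 1) (2 * n + 5) with hlt | hge
      · rw [Nat.mod_eq_of_lt hlt]
      · rw [show k + 1 = 0 + (2 * n + 5) by omega, cycPL_add, Nat.add_mod_right, Nat.zero_mod]
    have hk1lt : (k + 1) % (2 * n + 5) < 2 * n + 5 := Nat.mod_lt _ (by omega)
    rw [hk1'] at hne2 hAB ⊢
    have hA1 : 1 ≤ dsq (ω.cycPL h k) (ω.cycPL h j) := one_le_dsq_of_ne' (Ne.symm hne1)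
    have hB1 : 1 ≤ dsq (ω.cycPL h ((k + 1) % (2 * n + 5))) (ω.cycPL h j) := one_le_dsq_of_ne' (Ne.symm hne2)
    rcases Nat.lt_or_ge j (2 * n + 2) with hjw | hjc
    · have hkc : 2 * n + 1 ≤ k := by omega
      rcases (show k = 2 * n + 1 ∨ k = 2 * n + 2 ∨ k = 2 * n + 3 ∨ k = 2 * n + 4 by omega) with rfl | rfl | rfl | rfl
      · have hm : (2 * n + 1 + 1) % (2 * n + 5) = 2 * n + 2 := Nat.mod_eq_of_lt (by omega)
        rw [hm] at hne2 hB1 hAB ⊢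
        have hjne : j ≠ 2 * n + 1 := fun e => hne1 (by rw [e])
        have hB := (hidx (i := 2 * n + 2) (by omega) hne2 (Or.inl le_rfl)).2 (by omega)
        linarith
      · have hm : (2 * n + 2 + 1) % (2 * n + 5) = 2 * n + 3 := Nat.mod_eq_of_lt (by omega)
        rw [hm] at hne2 hB1 hAB ⊢
        have hA := (hidx (i := 2 * n + 2) (by omega) hne1 (Or.inl le_rfl)).1
        have hB := (hidx (i := 2 * n + 3) (by omega) hne2 (Or.inl (by omega))).2 (by omega)
        linarith
      · have hm : (2 * n + 3 + 1) % (2 * n + 5) = 2 * n + 4 := Nat.mod_eq_of_lt (by omega)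
        rw [hm] at hne2 hB1 hAB ⊢
        have hA := (hidx (i := 2 * n + 3) (by omega) hne1 (Or.inl (by omega))).2 (by omega)
        linarith
      · have hm : (2 * n + 4 + 1) % (2 * n + 5) = 0 := by rw [show 2 * n + 4 + 1 = 2 * n + 5 by ring, Nat.mod_self]
        rw [hm] at hne2 hB1 hAB ⊢
        have hA := (hidx (i := 2 * n + 4) (by omega) hne1 (Or.inl (by omega))).2 (by omega)
        linarith
    · have hA := hidx (i := k) hk hne1 (Or.inr hjc)
      have hB := hidx (i := (k + 1) % (2 * n + 5)) hk1lt hne2 (Or.inr hjc)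
      rcases (show j = 2 * n + 2 ∨ j = 2 * n + 3 ∨ j = 2 * n + 4 by omega) with rfl | rfl | rfl
      · by_cases hka : k = 2 * n + 1 ∨ k = 2 * n + 3
        · rcases hka with rfl | rfl
          · have hm : (2 * n + 1 + 1) % (2 * n + 5) = 2 * n + 2 := Nat.mod_eq_of_lt (by omega)
            rw [hm] at hne2; exact absurd rfl hne2
          · have hm : (2 * n + 3 + 1) % (2 * n + 5) = 2 * n + 4 := Nat.mod_eq_of_lt (by omega)
            rw [hm] at hB hB1 hAB ⊢
            have := hB.2 (by omega); have := hA.1; linarith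
        · push Not at hka
          have hA4 := hA.2 (by omega)
          have := hB.1; linarith
      · by_cases hka : k = 2 * n + 2
        · subst hka
          have hm : (2 * n + 2 + 1) % (2 * n + 5) = 2 * n + 3 := Nat.mod_eq_of_lt (by omega)
          rw [hm] at hne2; exact absurd rfl hne2
        · have hA4 := hA.2 (by omega)
          have := hB.1; linarith
      · have hA4 := hA.2 (by omega)
        have := hB.1; linarith

/-- ★ The exterior angles of the lateral whole-walk polygon add up to `winding(π/2)` (pattern `(E, N, W)`) or
`winding(π/2) + π` (pattern `(W, N, E)`). [cite: Hopf1935, Nr. 2 (Umlaufsatz, p. 53) and Nr. 4 eq. (22) (curves with corners, pp. 60–61)] -/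
theorem sum_extAng_cycPL (hh : holeFaceW w ∉ D) (hr : RootedFace D (w.side .W) (latN w)) (h : ω.IsB2a)
    (hz : ω.2.firstSideG = .E ∨ ω.2.firstSideG = .W) (h2 : ω.1 = ω.2.firstSideG.opp) :
    ∑ v ∈ Finset.range (2 * ω.2.arcs.length + 5), extAng (ω.cycPL h) v =
      ω.2.winding (fun _ => π / 2) + (if ω.2.firstSideG = .E then 0 else π) := by
  have hπ := Real.pi_pos
  have hwalk : ∑ v ∈ Finset.range (2 * ω.2.arcs.length), extAng (ω.cycPL h) v = ω.2.winding (fun _ => π / 2) := by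
    rw [← YBWalk.sum_ext_angles_eq_winding (γ := ω.2)]
    refine Finset.sum_congr rfl fun v hv => ?_
    rw [Finset.mem_range] at hv
    simp only [extAng, YBWalk.cvtx, cycPL_of_le h (show v ≤ 2 * ω.2.arcs.length + 1 by omega),
      cycPL_of_le h (show v + 1 ≤ 2 * ω.2.arcs.length + 1 by omega),
      cycPL_of_le h (show v + 2 ≤ 2 * ω.2.arcs.length + 1 by omega)]
  rw [show 2 * ω.2.arcs.length + 5 = 2 * ω.2.arcs.length + 1 + 1 + 1 + 1 + 1 by ring, Finset.sum_range_succ,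
    Finset.sum_range_succ, Finset.sum_range_succ, Finset.sum_range_succ, Finset.sum_range_succ, hwalk]
  have e0 := cycPL_penult hh hr h h2
  have e1 := cycPL_last (ω := ω) h
  have e2 := cycPL_q (ω := ω) h
  have e3 := cycPL_c₂ (ω := ω) h
  have e4 := cycPL_c₃ (ω := ω) h
  have e5 := cycPL_N (ω := ω) h
  have e6 := cycPL_N1 (ω := ω) hh h
  simp only [extAng]
  rw [show 2 * ω.2.arcs.length + 1 + 1 = 2 * ω.2.arcs.length + 2 by ring,
    show 2 * ω.2.arcs.length + 2 + 1 = 2 * ω.2.arcs.length + 3 by ring,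
    show 2 * ω.2.arcs.length + 3 + 1 = 2 * ω.2.arcs.length + 4 by ring,
    show 2 * ω.2.arcs.length + 4 + 1 = 2 * ω.2.arcs.length + 5 by ring,
    show 2 * ω.2.arcs.length + 2 + 2 = 2 * ω.2.arcs.length + 4 by ring,
    show 2 * ω.2.arcs.length + 3 + 2 = 2 * ω.2.arcs.length + 5 by ring,
    show 2 * ω.2.arcs.length + 4 + 2 = 2 * ω.2.arcs.length + 6 by ring,
    show 2 * ω.2.arcs.length + 1 + 2 = 2 * ω.2.arcs.length + 3 by ring,
    e0, e1, e2, e3, e4, e5, e6]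
  have hoff : ∀ s : Side, ω.1 = s.opp → (ω.1).offset = s.opp.offset := fun s hs' => by rw [hs']
  rw [hoff _ h2]
  simp only [toC_add_sub_add']
  have a20 : Complex.arg (toC (((2 : ℤ), (0 : ℤ)))) = 0 := arg_toC_pos_zero' (by norm_num)
  have a10 : Complex.arg (toC (((1 : ℤ), (0 : ℤ)))) = 0 := arg_toC_pos_zero' (by norm_num)
  have v1 : ((2 : ℤ), (2 : ℤ)) - ((2 : ℤ), (4 : ℤ)) = (0, -(2 : ℤ)) := by simp
  have v2 : ((4 : ℤ), (2 : ℤ)) - ((2 : ℤ), (2 : ℤ)) = (2, 0) := by simp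
  have v3 : ((5 : ℤ), (2 : ℤ)) - ((4 : ℤ), (2 : ℤ)) = (1, 0) := by simp
  rw [v1, v2, v3, arg_toC_zero_neg' two_pos, a20, a10]
  rcases hz with hz | hz <;> rw [hz] <;> simp only [Side.opp, Side.offset, Side.nIn, reduceCtorEq, if_true, if_false]
  · -- pattern (E, N, W): last (0,6), in (1,0), then (1,-1), (1,-1), (0,-2), (2,0), (1,0)
    have u1 : ((0 : ℤ), (4 : ℤ)) + ((0 : ℤ), (2 : ℤ)) - (((0 : ℤ), (4 : ℤ)) + ((0 : ℤ), (2 : ℤ)) + ((-1 : ℤ), (0 : ℤ))) = (1, 0) := by simp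
    have u2 : ((2 : ℤ), (5 : ℤ)) + ((-1 : ℤ), (0 : ℤ)) - (((0 : ℤ), (4 : ℤ)) + ((0 : ℤ), (2 : ℤ))) = (1, -1) := by simp
    have u3 : ((2 : ℤ), (4 : ℤ)) - (((2 : ℤ), (5 : ℤ)) + ((-1 : ℤ), (0 : ℤ))) = (1, -1) := by simp
    rw [u1, u2, u3, a10, arg_toC_one_neg_one']
    have t1 : (((-(π / 4) : ℝ) : Real.Angle) - (((0 : ℝ)) : Real.Angle)).toReal = -(π / 4) :=
      toReal_sub_coe' (by ring) ⟨by linarith, by linarith⟩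
    have t3 : (((-(π / 2) : ℝ) : Real.Angle) - (((-(π / 4)) : ℝ) : Real.Angle)).toReal = -(π / 4) :=
      toReal_sub_coe' (by ring) ⟨by linarith, by linarith⟩
    have t4 : (((0 : ℝ) : Real.Angle) - (((-(π / 2)) : ℝ) : Real.Angle)).toReal = π / 2 :=
      toReal_sub_coe' (by ring) ⟨by linarith, by linarith⟩
    rw [t1, t3, t4]
    simp only [sub_self, Real.Angle.toReal_zero]
    ring
  · -- pattern (W, N, E): last (4,6), in (-1,0), then (-1,-1), (-1,-1), (0,-2), (2,0), (1,0)
    have u1 : ((0 : ℤ), (4 : ℤ)) + ((4 : ℤ), (2 : ℤ)) - (((0 : ℤ), (4 : ℤ)) + ((4 : ℤ), (2 : ℤ)) + ((1 : ℤ), (0 : ℤ))) = (-(1 : ℤ), 0) := by simp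
    have u2 : ((2 : ℤ), (5 : ℤ)) + ((1 : ℤ), (0 : ℤ)) - (((0 : ℤ), (4 : ℤ)) + ((4 : ℤ), (2 : ℤ))) = (-1, -1) := by simp
    have u3 : ((2 : ℤ), (4 : ℤ)) - (((2 : ℤ), (5 : ℤ)) + ((1 : ℤ), (0 : ℤ))) = (-1, -1) := by simp
    rw [u1, u2, u3, arg_toC_neg_zero' one_pos, arg_toC_neg_one_neg_one']
    have t1 : (((-(3 * π / 4) : ℝ) : Real.Angle) - (((π : ℝ)) : Real.Angle)).toReal = π / 4 :=
      toReal_sub_coe_add' (by ring) ⟨by linarith, by linarith⟩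
    have t3 : (((-(π / 2) : ℝ) : Real.Angle) - (((-(3 * π / 4)) : ℝ) : Real.Angle)).toReal = π / 4 :=
      toReal_sub_coe' (by ring) ⟨by linarith, by linarith⟩
    have t4 : (((0 : ℝ) : Real.Angle) - (((-(π / 2)) : ℝ) : Real.Angle)).toReal = π / 2 :=
      toReal_sub_coe' (by ring) ⟨by linarith, by linarith⟩
    rw [t1, t3, t4]
    simp only [sub_self, Real.Angle.toReal_zero]
    ring

/-- ★★ Hopf for the lateral whole-walk polygon (corner patterns). [cite: Hopf1935, Nr. 2 (Umlaufsatz, p. 53) and Nr. 4 eq. (22) (curves with corners, pp. 60–61)] -/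
theorem winding_pi_div_two_corner_L (hh : holeFaceW w ∉ D) (hr : RootedFace D (w.side .W) (latN w)) (h : ω.IsB2a)
    (hz : ω.2.firstSideG = .E ∨ ω.2.firstSideG = .W) (h1 : ω.z1 hr h = .N) (h2 : ω.1 = ω.2.firstSideG.opp) :
    ω.2.winding (fun _ => π / 2) + (if ω.2.firstSideG = .E then 0 else π) = 2 * π ∨
      ω.2.winding (fun _ => π / 2) + (if ω.2.firstSideG = .E then 0 else π) = -(2 * π) := by
  have key := hopf_cyclic_int (ω.cycPL h) (N := 2 * ω.2.arcs.length + 5) (by omega) (cycPL_add h)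
    (fun i j hi hj e => cycPL_injective hh hr h hz h1 h2 hi hj e)
    (fun k j hk hj hne1 hne2 => cycPL_subtended hh hr h hz h1 h2 hk hj hne1 hne2)
  rwa [sum_extAng_cycPL hh hr h hz h2] at key

/-- ★★★ **THE SHORT TURNING IS FORCED at the lateral cell (corner patterns).** For a WOUND class-`B2a` walk at the
cell north of the hole with pattern `(E, N, W)`: `WP(π/2) = π`; with pattern `(W, N, E)`: `WP(π/2) = −2π`.
[cite: Hopf1935, Nr. 2 (Umlaufsatz, p. 53) and Nr. 4 eq. (22) (curves with corners, pp. 60–61)] [cite: GlazmanManolescu2019, Lemma 2.1 (proof: [Gl])] -/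
theorem WP_latN_eq_corner (hh : holeFaceW w ∉ D) (hr : RootedFace D (w.side .W) (latN w)) (h : ω.IsB2a)
    (hz : ω.2.firstSideG = .E ∨ ω.2.firstSideG = .W) (h1 : ω.z1 hr h = .N) (h2 : ω.1 = ω.2.firstSideG.opp)
    (hW : ω.WE (fun _ => π / 2) ≠ excursionWinding (π / 2) ω.2.firstSideG (ω.z1 hr h) ω.1) :
    (ω.2.firstSideG = .E → ω.WP (fun _ => π / 2) = π) ∧
      (ω.2.firstSideG = .W → ω.WP (fun _ => π / 2) = -(2 * π)) := by
  obtain ⟨hCE, hCW⟩ := WP_pi_div_two_mem_latN hh h hz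
  have hP := winding_pi_div_two_corner_L hh hr h hz h1 h2
  rw [winding_eq_WP_add_L hr h] at hP
  have hWE : ω.WE (fun _ => π / 2) - excursionWinding (π / 2) ω.2.firstSideG (ω.z1 hr h) ω.1 =
      4 * π * chordSign ω.2.firstSideG (ω.z1 hr h) ω.1 := by
    rcases ω.sign_law hr h (π / 2) with ⟨hWE, -⟩ | ⟨hWE, -⟩
    · exact absurd hWE hW
    · exact hWE
  rw [h1] at hWE hP
  constructor
  · intro hE
    have hω1 : ω.1 = .W := by rw [h2, hE]; rfl
    rw [hE] at hWE hP
    rw [hω1] at hWE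
    simp only [excursionWinding, arcTurn, if_true, show (chordSign .E .N .W : ℤ) = -1 by decide] at hWE hP
    push_cast at hWE
    rcases hCE hE with hC | hC
    · exact hC
    · exfalso; rcases hP with e | e <;> linarith [Real.pi_pos]
  · intro hWs
    have hω1 : ω.1 = .E := by rw [h2, hWs]; rfl
    rw [hWs] at hWE hP
    rw [hω1] at hWE
    simp only [excursionWinding, arcTurn, reduceCtorEq, if_false, show (chordSign .W .N .E : ℤ) = 1 by decide]
      at hWE hP
    push_cast at hWE
    rcases hCW hWs with hC | hC
    · exfalso; rcases hP with e | e <;> linarith [Real.pi_pos]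
    · exact hC

end WholeWalkL

end ΩG

end Literature.Probability.RandomPlanarGeometry.SAW.YangBaxter

namespace Literature.Probability.RandomPlanarGeometry.SAW.YangBaxter

open Real Complex

/-! ## The lateral-cell algebra: both routes point along `e^{i(3θ/8 + 5π/8)}` -/

section AlgebraL

/-- The direction of the lateral class terms: `e^{i(3θ/8 + 5π/8)}`. [cite: Glazman2015WeightedSAW, Lemma 3.1, eq. (1) (the weights)] -/
def latDir (θ : ℝ) : ℂ := Complex.exp (((3 * θ / 8 + 5 * π / 8 : ℝ) : ℂ) * Complex.I)

/-- `latDir` is a unit. [cite: Glazman2015WeightedSAW, Lemma 3.1, eq. (1) (the weights)] -/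
theorem norm_latDir (θ : ℝ) : ‖latDir θ‖ = 1 := by
  unfold latDir; exact Complex.norm_exp_ofReal_mul_I _

/-- `latDir` is nonzero. [cite: Glazman2015WeightedSAW, Lemma 3.1, eq. (1) (the weights)] -/
theorem latDir_ne_zero (θ : ℝ) : latDir θ ≠ 0 := by
  unfold latDir; exact Complex.exp_ne_zero _

/-- Two phases multiply by adding the angles. [folklore] -/
private theorem cexp_mul_cexp_L (a b : ℝ) :
    Complex.exp (((a : ℝ) : ℂ) * Complex.I) * Complex.exp (((b : ℝ) : ℂ) * Complex.I) = Complex.exp ((((a + b : ℝ)) : ℂ) * Complex.I) := by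
  rw [← Complex.exp_add]; congr 1; push_cast; ring

/-- `e^{iπ/2} = i`. [folklore] -/
private theorem cexp_half_pi_L : Complex.exp ((((π / 2 : ℝ)) : ℂ) * Complex.I) = Complex.I := by
  rw [Complex.exp_mul_I]
  rw [show ((π / 2 : ℝ) : ℂ) = (π : ℂ) / 2 by push_cast; ring, Complex.cos_pi_div_two, Complex.sin_pi_div_two]
  ring

/-- `e^{iπ} = −1`. [folklore] -/
private theorem cexp_pi_L : Complex.exp ((((π : ℝ)) : ℂ) * Complex.I) = -1 := by
  exact_mod_cast Complex.exp_pi_mul_I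

/-- ★ **Route `E`** (straight up from the root plaquette, turning `π`): `phase(π)·ε(E; z₁, z₂)·backBracket(θ; E, z₁, z₂, S)
= −v(θ)·e^{i(3θ/8 + 5π/8)}` for `{z₁, z₂} = {N, W}`. [cite: Glazman2015WeightedSAW, Lemma 3.1, eq. (1) (the weight v(θ))] [cite: GlazmanManolescu2019, Lemma 2.1 (proof: [Gl])] -/
theorem latN_termE (θ : ℝ) {z₁ z₂ z₃ : Side} (h1E : Side.E ≠ z₁) (h2E : Side.E ≠ z₂) (h12 : z₁ ≠ z₂)
    (h1S : z₁ ≠ .S) (h2S : z₂ ≠ .S) (h3 : z₃ ≠ .E ∧ z₃ ≠ z₁ ∧ z₃ ≠ z₂) :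
    phase π * ((chordSign .E z₁ z₂ : ℂ) * backBracket θ .E z₁ z₂ z₃) = -(weightV θ : ℂ) * latDir θ := by
  obtain ⟨h3a, h3b, h3c⟩ := h3
  have main : phase π * ((chordSign .E .N .W : ℂ) * backBracket θ .E .N .W .S) = -(weightV θ : ℂ) * latDir θ := by
    rw [show (chordSign .E .N .W : ℤ) = -1 by decide, backBracket_E_N_W_S, phase, latDir]
    simp only [Int.cast_neg, Int.cast_one]
    have key : Complex.exp ((((-(5 / 8 * π)) : ℝ) : ℂ) * Complex.I) * Complex.exp (((3 * θ / 8 + 5 * π / 4 : ℝ) : ℂ) * Complex.I)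
        = Complex.exp (((3 * θ / 8 + 5 * π / 8 : ℝ) : ℂ) * Complex.I) := by
      rw [cexp_mul_cexp_L, show (-(5 / 8 * π) + (3 * θ / 8 + 5 * π / 4) : ℝ) = 3 * θ / 8 + 5 * π / 8 by ring]
    linear_combination (-(weightV θ : ℂ)) * key
  obtain rfl | rfl : z₁ = .N ∨ z₁ = .W := by
    revert h1E h1S; cases z₁ <;> simp
  · obtain rfl : z₂ = .W := by revert h2E h2S h12; cases z₂ <;> simp
    obtain rfl : z₃ = .S := by revert h3a h3b h3c; cases z₃ <;> simp
    exact main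
  · obtain rfl : z₂ = .N := by revert h2E h2S h12; cases z₂ <;> simp
    obtain rfl : z₃ = .S := by revert h3a h3b h3c; cases z₃ <;> simp
    rw [ΩG.chordSign_mul_backBracket_swap θ (z₀ := .E) (z₁ := .N) (z₂ := .W) (z₃ := .S) (by decide) (by decide)
      (by decide) (by decide) (by decide) (by decide)]
    exact main

/-- ★ **Route `W`** (under and around the hole, turning `−2π`): `phase(−2π)·ε(W; z₁, z₂)·backBracket(θ; W, z₁, z₂, S)
= +v(θ)·e^{i(3θ/8 + 5π/8)}` for `{z₁, z₂} = {N, E}`. [cite: Glazman2015WeightedSAW, Lemma 3.1, eq. (1) (the weight v(θ))] [cite: GlazmanManolescu2019, Lemma 2.1 (proof: [Gl])] -/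
theorem latN_termW (θ : ℝ) {z₁ z₂ z₃ : Side} (h1W : Side.W ≠ z₁) (h2W : Side.W ≠ z₂) (h12 : z₁ ≠ z₂)
    (h1S : z₁ ≠ .S) (h2S : z₂ ≠ .S) (h3 : z₃ ≠ .W ∧ z₃ ≠ z₁ ∧ z₃ ≠ z₂) :
    phase (-(2 * π)) * ((chordSign .W z₁ z₂ : ℂ) * backBracket θ .W z₁ z₂ z₃) = (weightV θ : ℂ) * latDir θ := by
  obtain ⟨h3a, h3b, h3c⟩ := h3
  have main : phase (-(2 * π)) * ((chordSign .W .E .N : ℂ) * backBracket θ .W .E .N .S) = (weightV θ : ℂ) * latDir θ := by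
    rw [show (chordSign .W .E .N : ℤ) = -1 by decide, backBracket_W_E_N_S, phase, latDir]
    simp only [Int.cast_neg, Int.cast_one]
    have key : Complex.I * Complex.exp ((((-(5 / 8 * -(2 * π))) : ℝ) : ℂ) * Complex.I) *
        Complex.exp (((3 * θ / 8 - π / 8 : ℝ) : ℂ) * Complex.I) = -Complex.exp (((3 * θ / 8 + 5 * π / 8 : ℝ) : ℂ) * Complex.I) := by
      rw [show Complex.I * Complex.exp ((((-(5 / 8 * -(2 * π))) : ℝ) : ℂ) * Complex.I) =
          Complex.exp ((((π / 2 : ℝ)) : ℂ) * Complex.I) * Complex.exp ((((-(5 / 8 * -(2 * π))) : ℝ) : ℂ) * Complex.I) by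
            rw [cexp_half_pi_L],
        cexp_mul_cexp_L, cexp_mul_cexp_L,
        show (π / 2 + -(5 / 8 * -(2 * π)) + (3 * θ / 8 - π / 8) : ℝ) = (3 * θ / 8 + 5 * π / 8) + π by ring,
        ← cexp_mul_cexp_L (3 * θ / 8 + 5 * π / 8) π, cexp_pi_L]
      ring
    linear_combination (-(weightV θ : ℂ)) * key
  obtain rfl | rfl : z₁ = .E ∨ z₁ = .N := by
    revert h1W h1S; cases z₁ <;> simp
  · obtain rfl : z₂ = .N := by revert h2W h2S h12; cases z₂ <;> simp
    obtain rfl : z₃ = .S := by revert h3a h3b h3c; cases z₃ <;> simp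
    exact main
  · obtain rfl : z₂ = .E := by revert h2W h2S h12; cases z₂ <;> simp
    obtain rfl : z₃ = .S := by revert h3a h3b h3c; cases z₃ <;> simp
    rw [ΩG.chordSign_mul_backBracket_swap θ (z₀ := .W) (z₁ := .E) (z₂ := .N) (z₃ := .S) (by decide) (by decide)
      (by decide) (by decide) (by decide) (by decide)]
    exact main

end AlgebraL

namespace ΩG

variable {D : Set Face} {w : Face} {ω : ΩG D (w.side .W) (latN w)}

section AssemblyL

/-- Side bookkeeping: a side other than `z₀ ∈ {E, W}`, `N` and `S` is `z₀.opp`. [folklore] -/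
private theorem side_eq_opp_L {z₀ s : Side} (hz : z₀ = .E ∨ z₀ = .W) (h0 : s ≠ z₀) (hN : s ≠ .N) (hS : s ≠ .S) :
    s = z₀.opp := by
  rcases hz with rfl | rfl <;> cases s <;> simp_all [Side.opp]

/-- Side bookkeeping: a side other than `z₀ ∈ {E, W}`, `z₀.opp` and `S` is `N`. [folklore] -/
private theorem side_eq_N_L {z₀ s : Side} (hz : z₀ = .E ∨ z₀ = .W) (h0 : s ≠ z₀) (h1 : s ≠ z₀.opp) (hS : s ≠ .S) :
    s = .N := by
  rcases hz with rfl | rfl <;> cases s <;> simp_all [Side.opp]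

/-- ★ (R1) at the lateral cell: a wound class-`B2a` walk entered it from `E` or from `W`.
[cite: GlazmanManolescu2019, Lemma 2.1 (proof: [Gl])] [cite: Glazman2015WeightedSAW, Lemma 3.1 (proof, pp. 6–7)] -/
theorem firstSide_eq_E_or_W_of_wound (hh : holeFaceW w ∉ D) (ω : ΩG D (w.side .W) (latN w))
    (hr : RootedFace D (w.side .W) (latN w)) (h : ω.IsB2a) (hw : ω.AJ hr h (toC (midPt (w.side .W))) ≠ 0) :
    ω.2.firstSideG = .E ∨ ω.2.firstSideG = .W := by
  have hdoors := ω.exit_return_doors hr h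
  have hS1 : Side.S ≠ ω.z1 hr h := by
    intro e; rw [← e, latN_side_S_faces] at hdoors; exact hh hdoors.1.1
  have hS2 : Side.S ≠ ω.1 := by
    intro e; rw [← e, latN_side_S_faces] at hdoors; exact hh hdoors.2.1
  obtain ⟨h1, h2⟩ := ω.firstSide_lateral_of_woundFRL hr h hS1 hS2 hh (s := .N) (s' := .E) (holeFaceW_side_N w)
    (holeFaceW_side_E w) (latN_side_ne_root w) hw
  revert h1 h2
  generalize ω.2.firstSideG = z
  intro h1 h2
  cases z
  · exact Or.inr rfl
  · exact Or.inl rfl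
  · exact absurd rfl h1
  · exact absurd rfl h2

/-- ★★★ **THE SHORT TURNING IS FORCED at the lateral cell (every wound walk)**: first side `E` ⇒ `WP(π/2) = π`,
first side `W` ⇒ `WP(π/2) = −2π`; straight patterns by reversal.
[cite: Hopf1935, Nr. 2 (Umlaufsatz, p. 53) and Nr. 4 eq. (22) (curves with corners, pp. 60–61)] [cite: GlazmanManolescu2019, Lemma 2.1 (proof: [Gl])] -/
theorem WP_latN_eq_of_wound (hh : holeFaceW w ∉ D) (hr : RootedFace D (w.side .W) (latN w)) (h : ω.IsB2a)
    (hW : ω.WE (fun _ => π / 2) ≠ excursionWinding (π / 2) ω.2.firstSideG (ω.z1 hr h) ω.1) :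
    (ω.2.firstSideG = .E → ω.WP (fun _ => π / 2) = π) ∧ (ω.2.firstSideG = .W → ω.WP (fun _ => π / 2) = -(2 * π)) := by
  have hEW : ω.2.firstSideG = .E ∨ ω.2.firstSideG = .W := by
    rcases ω.AJ_ne_zero_or_rev_of_wound hr h (π / 2) hW with hA | hA
    · exact firstSide_eq_E_or_W_of_wound hh ω hr h hA
    · have h'' := ω.rev_isB2a hr h
      have hEW := firstSide_eq_E_or_W_of_wound hh (ω.rev hr) hr h'' hA
      rwa [ω.rev_firstSide hr h] at hEW
  obtain ⟨hz01, hz02, hz12⟩ := ω.firstSide_exit_return_distinct hr h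
  have hdoors := ω.exit_return_doors hr h
  have hS1 : ω.z1 hr h ≠ .S := by
    intro e; rw [e, latN_side_S_faces] at hdoors; exact hh hdoors.1.1
  have hS2 : ω.1 ≠ .S := by
    intro e; rw [e, latN_side_S_faces] at hdoors; exact hh hdoors.2.1
  by_cases hc : ω.z1 hr h = .N
  · have h2 : ω.1 = ω.2.firstSideG.opp :=
      side_eq_opp_L hEW (Ne.symm hz02) (fun e => hz12 (hc.trans e.symm)) hS2
    exact WP_latN_eq_corner hh hr h hEW hc h2 hW
  · have hz1 : ω.z1 hr h = ω.2.firstSideG.opp := side_eq_opp_L hEW (Ne.symm hz01) hc hS1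
    have h1' : ω.1 = .N := side_eq_N_L hEW (Ne.symm hz02) (fun e => hz12 (hz1.trans e.symm)) hS2
    have h'' := ω.rev_isB2a hr h
    have e1 : (ω.rev hr).z1 hr h'' = ω.1 := by unfold ΩG.z1; exact ω.rev_exitSide hr h
    have e2 : (ω.rev hr).1 = ω.z1 hr h := ω.rev_fst hr h
    have e0 : (ω.rev hr).2.firstSideG = ω.2.firstSideG := ω.rev_firstSide hr h
    have hWr : (ω.rev hr).WE (fun _ => π / 2) ≠
        excursionWinding (π / 2) (ω.rev hr).2.firstSideG ((ω.rev hr).z1 hr h'') (ω.rev hr).1 := by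
      rw [ω.rev_WE (fun _ => π / 2) hr h, e0, e1, e2, excursionWinding_swap]
      intro e; apply hW; linarith
    have key := WP_latN_eq_corner (ω := ω.rev hr) hh hr h'' (by rw [e0]; exact hEW) (by rw [e1]; exact h1')
      (by rw [e0, e2]; exact hz1) hWr
    rw [ω.rev_WP (fun _ => π / 2) hr h, e0] at key
    exact key

/-- **The prefix turning at the lateral cell does not depend on the angle** (root and first side are vertical
mid-edges). [cite: GlazmanManolescu2019, Lemma 2.1 (proof: [Gl])] -/
theorem WP_latN_const (h : ω.IsB2a) (θ : ℝ) (hz : ω.2.firstSideG = .E ∨ ω.2.firstSideG = .W) :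
    ω.WP (fun _ => θ) = ω.WP (fun _ => π / 2) := by
  have e : slantPot (fun _ => θ) (ω.2.nth ω.2.firstHitG) = 0 := by
    rw [ω.2.nth_firstHitG, slantPot_side]
    rcases hz with hz | hz <;> rw [hz] <;> simp [Side.slantInd]
  have e0 : slantPot (fun _ : ℤ => θ) (w.side .W) = 0 := by rw [slantPot_side]; simp [Side.slantInd]
  rw [← preL_winding h, ← preL_winding h, YBWalk.winding_eq_winding_pi_div_two_add (fun _ => θ) (ω.preL h), e, e0]
  ring

/-- **Woundness does not depend on the angle** (lateral cell): `WE(θ) − excursionWinding(θ; z₀, z₁, z₂)` is the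
same number at every constant angle. [cite: GlazmanManolescu2019, Lemma 2.1 (proof: [Gl])] -/
theorem WE_sub_excursionWinding_const_L (hr : RootedFace D (w.side .W) (latN w)) (h : ω.IsB2a) (θ : ℝ) :
    ω.WE (fun _ => θ) - excursionWinding θ ω.2.firstSideG (ω.z1 hr h) ω.1 =
      ω.WE (fun _ => π / 2) - excursionWinding (π / 2) ω.2.firstSideG (ω.z1 hr h) ω.1 := by
  obtain ⟨hz01, hz02, hz12⟩ := ω.firstSide_exit_return_distinct hr h
  have e1 := ω.WE_eq_WE_pi_div_two_add hr h (fun _ => θ)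
  have e2 := excursionWinding_theta θ hz01 hz02 hz12
  unfold ΩG.z1 at e2 ⊢
  rw [e1, e2]; ring

open Classical in
/-- **The route mass of a walk at the lateral cell**: its exterior weight if it is of class `B2a`, wound and entered
from the side `s`; else `0`. [cite: GlazmanManolescu2019, Lemma 2.1 (statement, "in the form given in [Gl]")] [cite: Glazman2015WeightedSAW, Lemma 3.1 (proof, pp. 6–7)] -/
noncomputable def routeMassL (θ : ℝ) (hr : RootedFace D (w.side .W) (latN w)) (s : Side)
    (ω : ΩG D (w.side .W) (latN w)) : ℝ :=
  if h : ω.IsB2a then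
    (if ω.2.firstSideG = s ∧ ω.WE (fun _ => θ) ≠ excursionWinding θ ω.2.firstSideG (ω.z1 hr h) ω.1 then
      ω.2.extWeight (fun _ => θ) (latN w) else 0)
  else 0

/-- Route masses are non-negative on `[π/3, 2π/3]`. [cite: GlazmanManolescu2019, eq. (1) (the weights are non-negative)] -/
theorem routeMassL_nonneg {θ : ℝ} (hθ : θ ∈ Set.Icc (π / 3) (2 * π / 3)) (hr : RootedFace D (w.side .W) (latN w))
    (s : Side) (ω : ΩG D (w.side .W) (latN w)) : 0 ≤ routeMassL θ hr s ω := by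
  unfold routeMassL
  split_ifs
  · exact Finset.prod_nonneg fun _ _ => localWeight_nonneg hθ _
  · exact le_rfl
  · exact le_rfl

/-- ★★ **THE CLASS TERM AT THE LATERAL CELL**: `classTerm = v(θ)·e^{i(3θ/8+5π/8)}·(routeMass_W − routeMass_E)`.
[cite: GlazmanManolescu2019, Lemma 2.1 (statement, "in the form given in [Gl]")] [cite: Glazman2015WeightedSAW, Lemma 3.1 (proof, pp. 6–7)] -/
theorem classTerm_latN (hh : holeFaceW w ∉ D) {θ : ℝ} (ω : ΩG D (w.side .W) (latN w))
    (hr : RootedFace D (w.side .W) (latN w)) (h : ω.IsB2a) :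
    ω.classTerm (fun _ => θ) hr =
      (weightV θ : ℂ) * latDir θ * ((routeMassL θ hr .W ω - routeMassL θ hr .E ω : ℝ) : ℂ) := by
  rcases ω.classTerm_dichotomy hr h θ with ⟨hWE, h0⟩ | ⟨hWE, hct⟩
  · rw [h0, routeMassL, routeMassL, dif_pos h, dif_pos h, if_neg (fun H => H.2 hWE), if_neg (fun H => H.2 hWE)]
    simp
  · obtain ⟨hz01, hz02, hz12⟩ := ω.firstSide_exit_return_distinct hr h
    have h3 := ω.z₃_spec hr h
    have hdoors := ω.exit_return_doors hr h
    have hS1 : ω.z1 hr h ≠ .S := by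
      intro e; rw [e, latN_side_S_faces] at hdoors; exact hh hdoors.1.1
    have hS2 : ω.1 ≠ .S := by
      intro e; rw [e, latN_side_S_faces] at hdoors; exact hh hdoors.2.1
    have hW2 : ω.WE (fun _ => π / 2) ≠ excursionWinding (π / 2) ω.2.firstSideG (ω.z1 hr h) ω.1 := by
      intro e; apply hWE
      have := WE_sub_excursionWinding_const_L (ω := ω) hr h θ
      linarith
    have hEW : ω.2.firstSideG = .E ∨ ω.2.firstSideG = .W := by
      rcases ω.AJ_ne_zero_or_rev_of_wound hr h θ hWE with hA | hA
      · exact firstSide_eq_E_or_W_of_wound hh ω hr h hA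
      · have h'' := ω.rev_isB2a hr h
        have hEW := firstSide_eq_E_or_W_of_wound hh (ω.rev hr) hr h'' hA
        rwa [ω.rev_firstSide hr h] at hEW
    obtain ⟨hE, hWt⟩ := WP_latN_eq_of_wound hh hr h hW2
    have htr := WP_latN_const (ω := ω) h θ hEW
    rw [hct, routeMassL, routeMassL, dif_pos h, dif_pos h]
    rcases hEW with hz0 | hz0
    · rw [if_neg (fun H => by rw [hz0] at H; exact absurd H.1 (by decide)), if_pos ⟨hz0, hWE⟩, htr, hE hz0, zero_sub]
      rw [hz0] at hz01 hz02 h3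
      rw [hz0, show (ω.2.extWeight (fun _ => θ) (latN w) : ℂ) * phase π * (chordSign Side.E (ω.z1 hr h) ω.1 : ℂ) *
          backBracket θ .E (ω.z1 hr h) ω.1 (ω.z₃ hr h) =
          (ω.2.extWeight (fun _ => θ) (latN w) : ℂ) * (phase π * ((chordSign Side.E (ω.z1 hr h) ω.1 : ℂ) *
            backBracket θ .E (ω.z1 hr h) ω.1 (ω.z₃ hr h))) by ring,
        latN_termE θ hz01 hz02 hz12 hS1 hS2 ⟨h3.1, h3.2.1, h3.2.2⟩]
      push_cast; ring
    · rw [if_pos ⟨hz0, hWE⟩, if_neg (fun H => by rw [hz0] at H; exact absurd H.1 (by decide)), htr, hWt hz0, sub_zero]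
      rw [hz0] at hz01 hz02 h3
      rw [hz0, show (ω.2.extWeight (fun _ => θ) (latN w) : ℂ) * phase (-(2 * π)) * (chordSign Side.W (ω.z1 hr h) ω.1 : ℂ) *
          backBracket θ .W (ω.z1 hr h) ω.1 (ω.z₃ hr h) =
          (ω.2.extWeight (fun _ => θ) (latN w) : ℂ) * (phase (-(2 * π)) * ((chordSign Side.W (ω.z1 hr h) ω.1 : ℂ) *
            backBracket θ .W (ω.z1 hr h) ω.1 (ω.z₃ hr h))) by ring,
        latN_termW θ hz01 hz02 hz12 hS1 hS2 ⟨h3.1, h3.2.1, h3.2.2⟩]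
      ring

variable [Finite D]

/-- ★★ The grouped sum at the lateral cell. [cite: GlazmanManolescu2019, Lemma 2.1 (statement, "in the form given in [Gl]")] [cite: Glazman2015WeightedSAW, Lemma 3.1 (proof, pp. 6–7)] -/
theorem sum_classTerm_latN (hh : holeFaceW w ∉ D) {θ : ℝ} (hr : RootedFace D (w.side .W) (latN w)) :
    ∑ ω ∈ setB2a D (w.side .W) (latN w), ω.classTerm (fun _ => θ) hr =
      (weightV θ : ℂ) * latDir θ * (((∑ ω ∈ setB2a D (w.side .W) (latN w), routeMassL θ hr .W ω) -
        ∑ ω ∈ setB2a D (w.side .W) (latN w), routeMassL θ hr .E ω : ℝ) : ℂ) := by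
  push_cast
  rw [← Finset.sum_sub_distrib, Finset.mul_sum]
  refine Finset.sum_congr rfl fun ω hω => ?_
  simp only [setB2a, Finset.mem_filter, Finset.mem_univ, true_and] at hω
  have h : ω.IsB2a := hω
  rw [classTerm_latN hh ω hr h]; push_cast; ring

end AssemblyL

end ΩG

end Literature.Probability.RandomPlanarGeometry.SAW.YangBaxter

/-! ## The lateral-cell law -/

namespace Literature.Barriers.CriticalPhenomena.PlaquetteWalk

open Literature.Probability.RandomPlanarGeometry.SAW.YangBaxter
open Real Complex

/-- ★★★★ **THE LATERAL-CELL LAW.** For every `θ ∈ [π/3, 2π/3]`, every finite face list `Dl`, every plaquette `w`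
whose `W`-neighbour (the hole) is not in the domain while the cell NORTH of the hole (`L = (w.1 − 1, w.2 + 1)`) is:
`VF_D(w.side W, L) = i · v(θ) · e^{i(3θ/8 + 5π/8)} · (M_W − M_E)`, `M_E, M_W ≥ 0` the total exterior weights of the
WOUND class-`B2a` walks at `L` entering from `E` (straight up from the root plaquette) resp. from `W` (under and
around the hole). So the defect at the lateral cell lies on the FIXED LINE `e^{i(3θ/8 + 9π/8)}·ℝ = r(θ)·e^{−3iπ/16}·ℝ`
(the venture lane's (H2), b-engine-1 g16). [cite: GlazmanManolescu2019, Lemma 2.1 (statement, "in the form given in [Gl]")]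
[cite: Glazman2015WeightedSAW, Lemma 3.1 (proof, pp. 6–7: the classes of walks through a rhombus)]
[cite: Hopf1935, Nr. 2 (Umlaufsatz, p. 53) and Nr. 4 eq. (22) (curves with corners, pp. 60–61)] -/
theorem vertexFunctional_printed_latN_eq {θ : ℝ} (hθ : θ ∈ Set.Icc (π / 3) (2 * π / 3))
    (Dl : List Face) (w : Face) (hf : latN w ∈ Dl) (hh : holeFaceW w ∉ dom Dl)
    (hr : RootedFace (dom Dl) (w.side .W) (latN w)) :
    vertexFunctional (printedWeights θ) tFiveEighths (ybCoeff θ) Dl (w.side .W) (latN w) =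
      Complex.I * (weightV θ : ℂ) * latDir θ *
        (((∑ ω ∈ ΩG.setB2a (dom Dl) (w.side .W) (latN w), ΩG.routeMassL θ hr .W ω) -
          ∑ ω ∈ ΩG.setB2a (dom Dl) (w.side .W) (latN w), ΩG.routeMassL θ hr .E ω : ℝ) : ℂ) := by
  have _ := hf
  rw [vertexFunctional_printed_eq_phase_mul_lem21Defect, ← ΩG.sum_g_eq_lem21Defect,
    ΩG.sum_g_eq_I_mul_sum_classTerm (fun _ => θ) hr (fun _ => hθ), ΩG.sum_classTerm_latN hh hr, slantPot_sideW]
  have e0 : Complex.exp (((-(5 / 8 * (0 : ℝ)) : ℝ) : ℂ) * Complex.I) = 1 := by simp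
  rw [e0, one_mul]; ring

/-- ★★★ **THE LATERAL HALF RELATION (H2)**: the defect at the lateral cell is a REAL multiple of
`i·e^{i(3θ/8 + 5π/8)}` — it vanishes iff the two route masses agree. [cite: GlazmanManolescu2019, Lemma 2.1 (statement, "in the form given in [Gl]")]
[cite: Glazman2015WeightedSAW, Lemma 3.1, eq. (1) (the weight v(θ))] [cite: Hopf1935, Nr. 2 (Umlaufsatz, p. 53) and Nr. 4 eq. (22) (curves with corners, pp. 60–61)] -/
theorem vertexFunctional_printed_latN_eq_zero_iff {θ : ℝ} (hθ : θ ∈ Set.Icc (π / 3) (2 * π / 3))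
    (Dl : List Face) (w : Face) (hf : latN w ∈ Dl) (hh : holeFaceW w ∉ dom Dl)
    (hr : RootedFace (dom Dl) (w.side .W) (latN w)) :
    vertexFunctional (printedWeights θ) tFiveEighths (ybCoeff θ) Dl (w.side .W) (latN w) = 0 ↔
      ∑ ω ∈ ΩG.setB2a (dom Dl) (w.side .W) (latN w), ΩG.routeMassL θ hr .W ω =
        ∑ ω ∈ ΩG.setB2a (dom Dl) (w.side .W) (latN w), ΩG.routeMassL θ hr .E ω := by
  have hv : (weightV θ : ℂ) ≠ 0 := by
    have hθ' : θ ∈ Set.Ioo 0 π := ⟨by linarith [hθ.1, Real.pi_pos], by linarith [hθ.2, Real.pi_pos]⟩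
    exact_mod_cast (weightV_pos_of_mem_Ioo hθ').ne'
  rw [vertexFunctional_printed_latN_eq hθ Dl w hf hh hr]
  constructor
  · intro h0
    rcases mul_eq_zero.1 h0 with h1 | h2
    · exact absurd h1 (mul_ne_zero (mul_ne_zero Complex.I_ne_zero hv) (latDir_ne_zero θ))
    · exact sub_eq_zero.1 (Complex.ofReal_eq_zero.1 h2)
  · intro h0; rw [h0, sub_self]; simp

end Literature.Barriers.CriticalPhenomena.PlaquetteWalk

/-! ## § The three doors of a wound walk at the lateral cell: the two-door zeros from the route masses

A wound class-`B2a` walk at `latN w` enters through `E` or `W`, exits through a second side and returns through a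
third, all distinct and none the dead side `S`; each must have its other face in the domain. Hence
`{z₀, z₁, z₂} = {E, W, N}` and all three live neighbours of `latN w` — `rootN w = (w.1, w.2 + 1)` (behind door `E`),
`farNW w` (behind door `W`, far-cell file) and `latNN w = (w.1 − 1, w.2 + 2)` (behind door `N`) — lie in the domain
(`ΩG.doors_of_wound_latN`); if any one is absent the printed vertex relation HOLDS at `latN w` for every
`θ ∈ [π/3, 2π/3]` (`…_latN_eq_zero_of_door_closed`): the catalogue's two-door zeros
(`PlaquetteWalk.vertexFunctional_printed_eq_zero_of_two_doors`), recovered from the route masses. -/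

namespace Literature.Probability.RandomPlanarGeometry.SAW.YangBaxter

open Real Complex

section LatCellNeighbours

/-- The cell NORTH of the root plaquette (behind the lateral cell's door `E`).
[cite: GlazmanManolescu2019, §1 (the lattice of rhombi and its mid-edges)] -/
def rootN (w : Face) : Face := (w.1, w.2 + 1)

/-- The cell NORTH of the lateral cell (behind its door `N`). [cite: GlazmanManolescu2019, §1 (the lattice of rhombi and its mid-edges)] -/
def latNN (w : Face) : Face := (w.1 - 1, w.2 + 2)

/-- `farNW.E = latN.W`. [cite: GlazmanManolescu2019, §1 (the lattice of rhombi and its mid-edges)] -/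
theorem farNW_side_E (w : Face) : (farNW w).side .E = (latN w).side .W := by
  obtain ⟨k, j⟩ := w
  show MidEdge.vert (k - 2 + 1) (j + 1) = MidEdge.vert (k - 1) (j + 1)
  congr 1; ring

/-- `rootN.W = latN.E`. [cite: GlazmanManolescu2019, §1 (the lattice of rhombi and its mid-edges)] -/
theorem rootN_side_W (w : Face) : (rootN w).side .W = (latN w).side .E := by
  obtain ⟨k, j⟩ := w
  show MidEdge.vert k (j + 1) = MidEdge.vert (k - 1 + 1) (j + 1)
  congr 1; ring

/-- The faces of the lateral cell's door `E`. [cite: GlazmanManolescu2019, §1 (the lattice of rhombi and its mid-edges)] -/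
theorem latN_side_E_faces (w : Face) : ((latN w).side .E).faces = (latN w, rootN w) := by
  obtain ⟨k, j⟩ := w
  show ((k - 1 + 1 - 1, j + 1), (k - 1 + 1, j + 1)) = ((k - 1, j + 1), (k, j + 1))
  rw [show k - 1 + 1 = k by ring]

/-- The faces of the lateral cell's door `W`. [cite: GlazmanManolescu2019, §1 (the lattice of rhombi and its mid-edges)] -/
theorem latN_side_W_faces (w : Face) : ((latN w).side .W).faces = (farNW w, latN w) := by
  obtain ⟨k, j⟩ := w
  show ((k - 1 - 1, j + 1), (k - 1, j + 1)) = ((k - 2, j + 1), (k - 1, j + 1))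
  rw [show k - 1 - 1 = k - 2 by ring]

/-- The faces of the lateral cell's door `N`. [cite: GlazmanManolescu2019, §1 (the lattice of rhombi and its mid-edges)] -/
theorem latN_side_N_faces (w : Face) : ((latN w).side .N).faces = (latN w, latNN w) := by
  obtain ⟨k, j⟩ := w
  show ((k - 1, j + 1 + 1 - 1), (k - 1, j + 1 + 1)) = ((k - 1, j + 1), (k - 1, j + 2))
  rw [show j + 1 + 1 - 1 = j + 1 by ring, show j + 1 + 1 = j + 2 by ring]

end LatCellNeighbours

/-- Side bookkeeping: three distinct sides, the first in `{E, W}`, none of the other two `S`, fill `{E, W, N}`. [folklore] -/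
private theorem three_doors_lat {z0 z1 z2 : Side} (h0 : z0 = .E ∨ z0 = .W) (h01 : z0 ≠ z1) (h02 : z0 ≠ z2)
    (h12 : z1 ≠ z2) (h1S : z1 ≠ .S) (h2S : z2 ≠ .S) :
    (z1 = .N ∨ z2 = .N) ∧ (z0 = .E ∨ z1 = .E ∨ z2 = .E) ∧ (z0 = .W ∨ z1 = .W ∨ z2 = .W) := by
  rcases h0 with rfl | rfl <;> cases z1 <;> cases z2 <;> simp_all

namespace ΩG

section LatCellDoors

variable {D : Set Face} {w : Face}

/-- ★ **Door `W` closed**: if the cell north of the far cell is not in the domain, no class-`B2a` walk at `latN w`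
entered it from `W`. [cite: GlazmanManolescu2019, Lemma 2.1 (proof: [Gl])] [cite: Glazman2015WeightedSAW, Lemma 3.1 (proof, pp. 6–7)] -/
theorem firstSide_ne_W_of_farNW (hg : farNW w ∉ D) (ω : ΩG D (w.side .W) (latN w))
    (hr : RootedFace D (w.side .W) (latN w)) (h : ω.IsB2a) : ω.2.firstSideG ≠ .W :=
  ω.firstSide_ne_deadFRL hr h hg (farNW_side_E w) (latN_side_ne_root (w := w))

/-- ★ **Door `E` closed**: if the cell north of the root plaquette is not in the domain, no class-`B2a` walk at
`latN w` entered it from `E`. [cite: GlazmanManolescu2019, Lemma 2.1 (proof: [Gl])] [cite: Glazman2015WeightedSAW, Lemma 3.1 (proof, pp. 6–7)] -/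
theorem firstSide_ne_E_of_rootN (hg : rootN w ∉ D) (ω : ΩG D (w.side .W) (latN w))
    (hr : RootedFace D (w.side .W) (latN w)) (h : ω.IsB2a) : ω.2.firstSideG ≠ .E :=
  ω.firstSide_ne_deadFRL hr h hg (rootN_side_W w) (latN_side_ne_root (w := w))

/-- A wound class-`B2a` walk at the lateral cell entered it from `E` or from `W` (both orientations).
[cite: GlazmanManolescu2019, Lemma 2.1 (proof: [Gl])] [cite: Glazman2015WeightedSAW, Lemma 3.1 (proof, pp. 6–7)] -/
theorem firstSide_eq_E_or_W_of_WE_ne (hh : holeFaceW w ∉ D) (ω : ΩG D (w.side .W) (latN w))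
    (hr : RootedFace D (w.side .W) (latN w)) (h : ω.IsB2a) {θ : ℝ}
    (hW : ω.WE (fun _ => θ) ≠ excursionWinding θ ω.2.firstSideG (ω.z1 hr h) ω.1) :
    ω.2.firstSideG = .E ∨ ω.2.firstSideG = .W := by
  rcases ω.AJ_ne_zero_or_rev_of_wound hr h θ hW with hA | hA
  · exact firstSide_eq_E_or_W_of_wound hh ω hr h hA
  · have h' := firstSide_eq_E_or_W_of_wound hh (ω.rev hr) hr (ω.rev_isB2a hr h) hA
    rwa [ω.rev_firstSide hr h] at h'

/-- ★★ **THREE-DOOR NECESSITY at the lateral cell.** A wound class-`B2a` walk at `latN w` uses all three live doors: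
the cells `rootN w`, `farNW w`, `latNN w` all lie in the domain.
[cite: GlazmanManolescu2019, Lemma 2.1 (proof: [Gl])] [cite: Glazman2015WeightedSAW, Lemma 3.1 (proof, pp. 6–7: the classes of walks through a rhombus)] -/
theorem doors_of_wound_latN (hh : holeFaceW w ∉ D) (ω : ΩG D (w.side .W) (latN w))
    (hr : RootedFace D (w.side .W) (latN w)) (h : ω.IsB2a) {θ : ℝ}
    (hW : ω.WE (fun _ => θ) ≠ excursionWinding θ ω.2.firstSideG (ω.z1 hr h) ω.1) :
    rootN w ∈ D ∧ farNW w ∈ D ∧ latNN w ∈ D := by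
  obtain ⟨hz01, hz02, hz12⟩ := ω.firstSide_exit_return_distinct hr h
  have hdoors := ω.exit_return_doors hr h
  have hz0 := firstSide_eq_E_or_W_of_WE_ne hh ω hr h hW
  have h1S : ω.z1 hr h ≠ .S := by
    intro e; rw [e, latN_side_S_faces] at hdoors; exact hh hdoors.1.1
  have h2S : ω.1 ≠ .S := by
    intro e; rw [e, latN_side_S_faces] at hdoors; exact hh hdoors.2.1
  obtain ⟨hNd, hEd, hWd⟩ := three_doors_lat hz0 hz01 hz02 hz12 h1S h2S
  refine ⟨?_, ?_, ?_⟩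
  · rcases hEd with e | e | e
    · by_contra hg; exact firstSide_ne_E_of_rootN hg ω hr h e
    · have t := hdoors.1.2; rw [e, latN_side_E_faces] at t; exact t
    · have t := hdoors.2.2; rw [e, latN_side_E_faces] at t; exact t
  · rcases hWd with e | e | e
    · by_contra hg; exact firstSide_ne_W_of_farNW hg ω hr h e
    · have t := hdoors.1.1; rw [e, latN_side_W_faces] at t; exact t
    · have t := hdoors.2.1; rw [e, latN_side_W_faces] at t; exact t
  · rcases hNd with e | e
    · have t := hdoors.1.2; rw [e, latN_side_N_faces] at t; exact t
    · have t := hdoors.2.2; rw [e, latN_side_N_faces] at t; exact t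

/-- With a door closed every lateral route mass vanishes. [cite: GlazmanManolescu2019, Lemma 2.1 (proof: [Gl])] -/
theorem routeMassL_eq_zero_of_door_closed (hh : holeFaceW w ∉ D) (hg : rootN w ∉ D ∨ farNW w ∉ D ∨ latNN w ∉ D)
    (θ : ℝ) (hr : RootedFace D (w.side .W) (latN w)) (s : Side) (ω : ΩG D (w.side .W) (latN w)) :
    routeMassL θ hr s ω = 0 := by
  unfold routeMassL
  split_ifs with h H
  · obtain ⟨h1, h2, h3⟩ := doors_of_wound_latN hh ω hr h H.2
    rcases hg with hg | hg | hg
    · exact absurd h1 hg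
    · exact absurd h2 hg
    · exact absurd h3 hg
  · rfl
  · rfl

end LatCellDoors

end ΩG

end Literature.Probability.RandomPlanarGeometry.SAW.YangBaxter

namespace Literature.Barriers.CriticalPhenomena.PlaquetteWalk

open Literature.Probability.RandomPlanarGeometry.SAW.YangBaxter
open Real Complex

/-- ★★ **A CLOSED DOOR KILLS THE LATERAL DEFECT.** If any of the three live neighbours of `latN w` is not in the
domain, the printed Yang–Baxter vertex relation HOLDS at `latN w`, for every `θ ∈ [π/3, 2π/3]`.
[cite: GlazmanManolescu2019, Lemma 2.1 (statement, "in the form given in [Gl]")] [cite: Glazman2015WeightedSAW, Lemma 3.1 (proof, pp. 6–7)] -/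
theorem vertexFunctional_printed_latN_eq_zero_of_door_closed {θ : ℝ} (hθ : θ ∈ Set.Icc (π / 3) (2 * π / 3))
    (Dl : List Face) (w : Face) (hf : latN w ∈ Dl) (hh : holeFaceW w ∉ dom Dl)
    (hg : rootN w ∉ dom Dl ∨ farNW w ∉ dom Dl ∨ latNN w ∉ dom Dl)
    (hr : RootedFace (dom Dl) (w.side .W) (latN w)) :
    vertexFunctional (printedWeights θ) tFiveEighths (ybCoeff θ) Dl (w.side .W) (latN w) = 0 := by
  rw [vertexFunctional_printed_latN_eq_zero_iff hθ Dl w hf hh hr,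
    Finset.sum_eq_zero (fun ω _ => ΩG.routeMassL_eq_zero_of_door_closed hh hg θ hr .W ω),
    Finset.sum_eq_zero (fun ω _ => ΩG.routeMassL_eq_zero_of_door_closed hh hg θ hr .E ω)]

end Literature.Barriers.CriticalPhenomena.PlaquetteWalk

/-! ## The honeycomb point at the LATERAL cell (edition 4; venture lane «pcv-sawmu», b-step0 gen 18)

The companion file's § honeycomb point (`PlaquetteWalkHoleRootFarCellLaw`, edition 6: at `θ = π/3` the exterior weight
of a walk is `x_c ^ hexEdgesOff` if no rhombus off the cell carries two co-corner arcs and `0` otherwise) specialises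
THE LATERAL-CELL LAW the same way: ★★ `PlaquetteWalk.vertexFunctional_printed_latN_pi_div_three_eq` —
`VF_D(w.side W, L; π/3) = i·x_c²·e^{3iπ/4}·(Σ_{W, w₂-free wound} x_c^ℓ − Σ_{E, w₂-free wound} x_c^ℓ)`; the ROUTE KILLS
`…_latN_pi_div_three_ne_zero_of_east_killed` / `_of_west_killed` and the HONEYCOMB ZERO
`…_latN_pi_div_three_eq_zero_of_killed` at the lateral cell. -/

namespace Literature.Probability.RandomPlanarGeometry.SAW.YangBaxter

open Real

namespace ΩG

variable {D : Set Face} {w : Face}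

open Classical in
/-- **The honeycomb route mass at the lateral cell**: `x_c ^ (honeycomb length off the lateral cell)` if the walk is of
class `B2a`, wound, first entered the lateral cell from the side `s` and is `w₂`-free off it; else `0`.
[cite: GlazmanManolescu2019, §4 (first paragraph)] [cite: Glazman2015WeightedSAW, Lemma 3.1 (proof, pp. 6–7: the classes of walks through a rhombus)] -/
noncomputable def hexRouteMassL (hr : RootedFace D (w.side .W) (latN w)) (s : Side)
    (ω : ΩG D (w.side .W) (latN w)) : ℝ :=
  if h : ω.IsB2a then
    (if ω.2.firstSideG = s ∧ ω.WE (fun _ => π / 3) ≠ excursionWinding (π / 3) ω.2.firstSideG (ω.z1 hr h) ω.1 ∧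
        ω.2.W2FreeOff (latN w) then hexCriticalFugacity ^ ω.2.hexEdgesOff (latN w) else 0)
  else 0

/-- ★ At `θ = π/3` the route mass at the lateral cell IS the honeycomb route mass. [cite: GlazmanManolescu2019, §4 (first paragraph)] -/
theorem routeMassL_pi_div_three_eq (hr : RootedFace D (w.side .W) (latN w)) (s : Side)
    (ω : ΩG D (w.side .W) (latN w)) : routeMassL (π / 3) hr s ω = hexRouteMassL hr s ω := by
  unfold routeMassL hexRouteMassL
  by_cases h : ω.IsB2a
  · simp only [dif_pos h]
    by_cases hab : ω.2.firstSideG = s ∧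
        ω.WE (fun _ => π / 3) ≠ excursionWinding (π / 3) ω.2.firstSideG (ω.z1 hr h) ω.1
    · rw [if_pos hab]
      by_cases hc : ω.2.W2FreeOff (latN w)
      · rw [if_pos ⟨hab.1, hab.2, hc⟩, ω.2.extWeight_pi_div_three_eq_pow _ hc]
      · rw [if_neg fun h3 => hc h3.2.2, ω.2.extWeight_pi_div_three_eq_zero _ hc]
    · rw [if_neg hab, if_neg fun h3 => hab ⟨h3.1, h3.2.1⟩]
  · simp only [dif_neg h]

/-- A route at the lateral cell all of whose wound walks are `w₂`-marked has route mass ZERO at `θ = π/3`.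
[cite: GlazmanManolescu2019, §1 (the paragraph of Fig. 2: «if θ = π/3, then w₂ = 0»)] -/
theorem sum_routeMassL_pi_div_three_eq_zero_of_killed [Finite D] (hr : RootedFace D (w.side .W) (latN w)) (s : Side)
    (hK : ∀ (ω : ΩG D (w.side .W) (latN w)) (h : ω.IsB2a), ω.2.firstSideG = s →
      ω.WE (fun _ => π / 3) ≠ excursionWinding (π / 3) ω.2.firstSideG (ω.z1 hr h) ω.1 → ¬ω.2.W2FreeOff (latN w)) :
    ∑ ω ∈ setB2a D (w.side .W) (latN w), routeMassL (π / 3) hr s ω = 0 := by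
  classical
  refine Finset.sum_eq_zero fun ω _ => ?_
  unfold routeMassL
  split_ifs with h1 h2
  · exact ω.2.extWeight_pi_div_three_eq_zero _ (hK ω h1 h2.1 h2.2)
  · rfl
  · rfl

/-- A route at the lateral cell with a `w₂`-free wound walk has POSITIVE route mass at `θ = π/3`.
[cite: GlazmanManolescu2019, §4 (first paragraph)] -/
theorem sum_routeMassL_pi_div_three_pos_of_free [Finite D] (hr : RootedFace D (w.side .W) (latN w)) (s : Side)
    (hF : ∃ (ω : ΩG D (w.side .W) (latN w)) (h : ω.IsB2a), ω.2.firstSideG = s ∧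
      ω.WE (fun _ => π / 3) ≠ excursionWinding (π / 3) ω.2.firstSideG (ω.z1 hr h) ω.1 ∧ ω.2.W2FreeOff (latN w)) :
    0 < ∑ ω ∈ setB2a D (w.side .W) (latN w), routeMassL (π / 3) hr s ω := by
  classical
  have hθ : (π / 3 : ℝ) ∈ Set.Icc (π / 3) (2 * π / 3) := ⟨le_rfl, by linarith [Real.pi_pos]⟩
  obtain ⟨ω₀, h₀, hz₀, hW₀, hF₀⟩ := hF
  have hmem : ω₀ ∈ setB2a D (w.side .W) (latN w) := by
    simp only [setB2a, Finset.mem_filter, Finset.mem_univ, true_and]; exact h₀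
  refine lt_of_lt_of_le ?_ (Finset.single_le_sum (fun ω _ => routeMassL_nonneg hθ hr s ω) hmem)
  unfold routeMassL
  rw [dif_pos h₀, if_pos ⟨hz₀, hW₀⟩]
  exact ω₀.2.extWeight_pi_div_three_pos _ hF₀

end ΩG

end Literature.Probability.RandomPlanarGeometry.SAW.YangBaxter

namespace Literature.Barriers.CriticalPhenomena.PlaquetteWalk

open Literature.Probability.RandomPlanarGeometry.SAW.YangBaxter
open Literature.Probability.RandomPlanarGeometry.SAW (hexCriticalFugacity)
open Real Complex

/-- `π/3` lies in the printed range. [folklore] -/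
private theorem pi_div_three_mem_Icc_L : (π / 3 : ℝ) ∈ Set.Icc (π / 3) (2 * π / 3) :=
  ⟨le_rfl, by linarith [Real.pi_pos]⟩

/-- ★★ **THE HONEYCOMB LATERAL-CELL LAW.** At `θ = π/3` the vertex functional of the hole root `w.side W` at the
lateral cell `L = latN w` is `i · x_c² · e^{i(π/8 + 5π/8)} · (Σ_{W} x_c^{ℓ(ω)} − Σ_{E} x_c^{ℓ(ω)})` over the `w₂`-free
wound class-`B2a` walks at `L` entering from `W` resp. `E`, `ℓ` = honeycomb edges off `L`.
[cite: GlazmanManolescu2019, §4 (first paragraph: «SAW on H(π/3) is identical to that on the hexagonal lattice with the weight of a path γ given by (√(2+√2))^{−|γ|}»)]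
[cite: GlazmanManolescu2019, Lemma 2.1 (statement, "in the form given in [Gl]")] [cite: Glazman2015WeightedSAW, Lemma 3.1 (proof, pp. 6–7)] -/
theorem vertexFunctional_printed_latN_pi_div_three_eq (Dl : List Face) (w : Face) (hf : latN w ∈ Dl)
    (hh : holeFaceW w ∉ dom Dl) (hr : RootedFace (dom Dl) (w.side .W) (latN w)) :
    vertexFunctional (printedWeights (π / 3)) tFiveEighths (ybCoeff (π / 3)) Dl (w.side .W) (latN w) =
      Complex.I * ((hexCriticalFugacity ^ 2 : ℝ) : ℂ) * latDir (π / 3) *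
        (((∑ ω ∈ ΩG.setB2a (dom Dl) (w.side .W) (latN w), ΩG.hexRouteMassL hr .W ω) -
          ∑ ω ∈ ΩG.setB2a (dom Dl) (w.side .W) (latN w), ΩG.hexRouteMassL hr .E ω : ℝ) : ℂ) := by
  rw [vertexFunctional_printed_latN_eq pi_div_three_mem_Icc_L Dl w hf hh hr, weightV_pi_div_three]
  simp only [ΩG.routeMassL_pi_div_three_eq]

/-- ★★ **ROUTE KILL AT THE LATERAL CELL (east route killed), `θ = π/3`.** Every wound walk entering the lateral
cell from `E` carries a double co-corner rhombus off it, some wound walk entering from `W` does not ⇒ `VF ≠ 0`.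
[cite: GlazmanManolescu2019, Lemma 2.1 (statement, "in the form given in [Gl]")] [cite: GlazmanManolescu2019, §1 (the paragraph of Fig. 2)] -/
theorem vertexFunctional_printed_latN_pi_div_three_ne_zero_of_east_killed (Dl : List Face) (w : Face)
    (hf : latN w ∈ Dl) (hh : holeFaceW w ∉ dom Dl) (hr : RootedFace (dom Dl) (w.side .W) (latN w))
    (hE : ∀ (ω : ΩG (dom Dl) (w.side .W) (latN w)) (h : ω.IsB2a), ω.2.firstSideG = .E →
      ω.WE (fun _ => π / 3) ≠ excursionWinding (π / 3) ω.2.firstSideG (ω.z1 hr h) ω.1 → ¬ω.2.W2FreeOff (latN w))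
    (hW : ∃ (ω : ΩG (dom Dl) (w.side .W) (latN w)) (h : ω.IsB2a), ω.2.firstSideG = .W ∧
      ω.WE (fun _ => π / 3) ≠ excursionWinding (π / 3) ω.2.firstSideG (ω.z1 hr h) ω.1 ∧ ω.2.W2FreeOff (latN w)) :
    vertexFunctional (printedWeights (π / 3)) tFiveEighths (ybCoeff (π / 3)) Dl (w.side .W) (latN w) ≠ 0 := by
  rw [Ne, vertexFunctional_printed_latN_eq_zero_iff pi_div_three_mem_Icc_L Dl w hf hh hr,
    ΩG.sum_routeMassL_pi_div_three_eq_zero_of_killed hr .E hE]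
  exact (ΩG.sum_routeMassL_pi_div_three_pos_of_free hr .W hW).ne'

/-- ★★ **ROUTE KILL AT THE LATERAL CELL (west route killed), `θ = π/3`.** Every wound walk entering the lateral cell
from `W` (under and around the hole) carries a double co-corner rhombus off it, some wound walk entering from `E` does
not ⇒ `VF ≠ 0`. (Venture lane, exact enumeration at the lateral cell: `6 × 5 ∖ {(3,2),(0,4),(5,0),(1,0)}`, root `W` of
`(4,2)`: 992 east / 80 west wound walks, west 0 `w₂`-free, east 336; `6 × 5 ∖ {(2,2),(0,0),(4,2)}`, root `W` of `(3,2)`: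
1024 / 64, west 0 `w₂`-free, east 384.)
[cite: GlazmanManolescu2019, Lemma 2.1 (statement, "in the form given in [Gl]")] [cite: GlazmanManolescu2019, §1 (the paragraph of Fig. 2)] -/
theorem vertexFunctional_printed_latN_pi_div_three_ne_zero_of_west_killed (Dl : List Face) (w : Face)
    (hf : latN w ∈ Dl) (hh : holeFaceW w ∉ dom Dl) (hr : RootedFace (dom Dl) (w.side .W) (latN w))
    (hW : ∀ (ω : ΩG (dom Dl) (w.side .W) (latN w)) (h : ω.IsB2a), ω.2.firstSideG = .W →
      ω.WE (fun _ => π / 3) ≠ excursionWinding (π / 3) ω.2.firstSideG (ω.z1 hr h) ω.1 → ¬ω.2.W2FreeOff (latN w))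
    (hE : ∃ (ω : ΩG (dom Dl) (w.side .W) (latN w)) (h : ω.IsB2a), ω.2.firstSideG = .E ∧
      ω.WE (fun _ => π / 3) ≠ excursionWinding (π / 3) ω.2.firstSideG (ω.z1 hr h) ω.1 ∧ ω.2.W2FreeOff (latN w)) :
    vertexFunctional (printedWeights (π / 3)) tFiveEighths (ybCoeff (π / 3)) Dl (w.side .W) (latN w) ≠ 0 := by
  rw [Ne, vertexFunctional_printed_latN_eq_zero_iff pi_div_three_mem_Icc_L Dl w hf hh hr,
    ΩG.sum_routeMassL_pi_div_three_eq_zero_of_killed hr .W hW]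
  exact (ΩG.sum_routeMassL_pi_div_three_pos_of_free hr .E hE).ne

/-- ★★ **THE HONEYCOMB ZERO AT THE LATERAL CELL**: no `w₂`-free wound walk at the lateral cell ⇒ the vertex relation
holds there at `θ = π/3`. [cite: GlazmanManolescu2019, Lemma 2.1 (statement, "in the form given in [Gl]")] [cite: GlazmanManolescu2019, §1 (the paragraph of Fig. 2: «if θ = π/3, then w₂ = 0»)] -/
theorem vertexFunctional_printed_latN_pi_div_three_eq_zero_of_killed (Dl : List Face) (w : Face)
    (hf : latN w ∈ Dl) (hh : holeFaceW w ∉ dom Dl) (hr : RootedFace (dom Dl) (w.side .W) (latN w))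
    (hK : ∀ (ω : ΩG (dom Dl) (w.side .W) (latN w)) (h : ω.IsB2a),
      ω.WE (fun _ => π / 3) ≠ excursionWinding (π / 3) ω.2.firstSideG (ω.z1 hr h) ω.1 → ¬ω.2.W2FreeOff (latN w)) :
    vertexFunctional (printedWeights (π / 3)) tFiveEighths (ybCoeff (π / 3)) Dl (w.side .W) (latN w) = 0 := by
  rw [vertexFunctional_printed_latN_eq_zero_iff pi_div_three_mem_Icc_L Dl w hf hh hr,
    ΩG.sum_routeMassL_pi_div_three_eq_zero_of_killed hr .W fun ω h _ hW => hK ω h hW,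
    ΩG.sum_routeMassL_pi_div_three_eq_zero_of_killed hr .E fun ω h _ hW => hK ω h hW]

end Literature.Barriers.CriticalPhenomena.PlaquetteWalk
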